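import Literature.Analysis.FluidPDE.TorusPressurePoisson
import Literature.Analysis.FluidPDE.DuchonRobertInviscidLimit
import Literature.Analysis.FluidPDE.EnergyToolkit
import Literature.Analysis.FunctionSpaces.TorusMollifierEstimates
import Literature.Analysis.FunctionSpaces.TorusLerayHelmholtz
import Literature.Analysis.FunctionSpaces.TorusSpaceTimeFields
import Literature.Analysis.FunctionSpaces.TorusCommutatorEstimate
import HarnessLib

/-!
# The pressure of `L³` weak solutions on the torus: proof of `Torus.exists_pressure_of_tendsto_L3`

Analysis/FluidPDE proof file. It discharges — **modulo the Calderón–Zygmund fact**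
`Torus.eLpNorm_hessian_le_laplacian` (`FunctionSpaces/TorusRieszTransform`; Robinson–Rodrigo–Sadowski
2016, Thm. B.7) — the named fact `Torus.exists_pressure_of_tendsto_L3` of
`FluidPDE/DuchonRobertInviscidLimit`, hypothesis (A1) of the assembly
`Torus.IsDissipationMeasureOf.hasDuchonRobertDefect_of` of Duchon–Robert's Prop. 4
(Duchon–Robert 2000, p. 253):

* `Torus.exists_pressure_of_tendsto_L3_of (hCZ : eLpNorm_hessian_le_laplacian d) :
  exists_pressure_of_tendsto_L3` — if `u_m` (eventually) and `u` are pressure-free weak solutions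
  on `T^d × (0,T)` with `u ∈ L³_{t,x}` and `u_m → u` in `L³_{t,x}`, there are pressures
  `p_m, p ∈ L^{3/2}_{t,x}` making `(u_m, p_m)` (eventually) and `(u, p)` distributional solutions,
  with `p_m → p` in `L^{3/2}_{t,x}` (Duchon–Robert 2000, proof of Prop. 1; Robinson–Rodrigo–Sadowski
  2016, Lemma 5.1 (5.7), (5.10) and Prop. 5.3).

Once `eLpNorm_hessian_le_laplacian_holds` is in the tree, `exists_pressure_of_tendsto_L3_holds` is
the one-liner `exists_pressure_of_tendsto_L3_of eLpNorm_hessian_le_laplacian_holds`.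

## The argument (Robinson–Rodrigo–Sadowski 2016, §5.1–5.2, on `T^d`)

1. **The pressure** (`Torus.exists_pressure_of_isWeakNSSolutionOn`): for `u ∈ L³((0,T) × T^d)` the
   velocity tensor `(u ⊗ u)ᵢⱼ = uᵢuⱼ` (`Torus.velTensor`) is in `L^{3/2}` (`|uᵢuⱼ| ≤ ‖u‖²`), and the
   pressure `P` is the `L^{3/2}` limit of the approximate pressures `-∑ᵢⱼ∂ᵢ∂ⱼΔ⁻¹((uᵢuⱼ) ⋆ ρₙ)` of
   `FluidPDE/TorusPressurePoisson` (`Torus.exists_pressure` at `p = 3/2`): jointly measurable,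
   `∫∫|P|^{3/2} ≤ K ∑ᵢⱼ ∫∫ |uᵢuⱼ|^{3/2}`, and for a.e. `t`, `∫ P(t)Δθ = -∑ᵢⱼ ∫ uᵢuⱼ(t) ∂ᵢ∂ⱼθ` for all
   smooth `θ` (RRS Lemma 5.1).
2. **Distributional solutions** (`Torus.IsWeakNSSolutionOn.isDistributionalNSSolutionOn_of_pressure`,
   RRS Prop. 5.3 and its proof): a test field `ψ` supported in `(0,T)` splits as `ψ = w + ∇φ`,
   `φ = Δ⁻¹ div ψ` (`Torus.testPotential`, jointly smooth by the tree's
   `Torus.IsSmoothSpaceTimeOn.invLaplacian`), `w` divergence free and again a test field supported in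
   `(0,T)` (`Torus.testSolenoidal`); `w` is admissible in the pressure-free weak formulation, and the
   gradient part tests to zero slice-wise (`Torus.integral_gradientPart_eq_zero`): `∂ₜ∇φ = ∇∂ₜφ`
   (Schwarz in `(t,x)`, `Torus.timeDeriv_gradient_comm`, via the tree's Euclidean
   `FluidPDE.IsSmoothSpaceTimeOn.timeDerivWithin_fderiv_slice_apply`) and `Δ∇φ = ∇Δφ`
   (`Torus.laplacian_gradient`) are gradients of smooth functions, killed by weak
   divergence-freeness, while `∫⟪u,(u·∇)∇φ⟫ = ∑ᵢⱼ∫uᵢuⱼ∂ᵢ∂ⱼφ = -∫ PΔφ` by the weak Poisson equation;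
   `div ψ = Δφ` since `div w = 0`.
3. **Continuity** (`Torus.tendsto_lintegral_velTensor_sub`): `|vᵢvⱼ - uᵢuⱼ| ≤ ‖v-u‖(‖v‖+‖u‖)` and
   Cauchy–Schwarz give `∫∫|u_m ⊗ u_m - u ⊗ u|^{3/2} ≤ (∫∫‖u_m-u‖³)^{1/2}(4(∫∫‖u_m‖³ + ∫∫‖u‖³))^{1/2} → 0`,
   and the pressures inherit this by `Torus.lintegral_prod_rpow_pressure_sub_le` (Duchon–Robert
   2000, proof of Prop. 1: "the linear operator `uᵢuₖ → p` is strongly continuous on `L^q`").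
4. The approximants `u_m` are weak solutions and in `L³` only eventually; the pressures `p_m` are
   defined by step 1 at those indices (and `0` at the finitely many others). For an empty index
   type all fields vanish and zero pressures do (`Torus.isDistributionalNSSolutionOn_zero_of_isEmpty`).

## Mathlib / tree search

Mathlib (this pin): Schwarz (`ContDiffAt.isSymmSndFDerivAt`, used through the tree's
`FluidPDE/EnergyToolkit`), `ENNReal.lintegral_mul_le_Lp_mul_Lq`,
`eLpNorm_le_eLpNorm_mul_rpow_measure_univ`. Tree: `FluidPDE/TorusPressurePoisson` (the pressure
operator), `FluidPDE/DuchonRobertInviscidLimit` (the target fact and the `(0,T) × T^d` glue: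
`aestronglyMeasurable_uncurry_prod`, `lintegral_Ioo_lintegral_eq_lintegral_prod`,
`eventually_lintegral_enorm_pow_three_lt_top`, `ENNReal.sq_rpow_three_halves`),
`TorusSpaceTimeFields` (`aestronglyMeasurable_stLift_of_uncurry`), `TorusLerayHelmholtz`
(`divergence_sub`, `fderiv_sub`), `TorusMollifierEstimates` (`gradient_apply`),
`TorusEnstrophyOrthogonality` (`fderiv_apply_coord`), `TorusCommutatorEstimate` (the exponent-`3/2`
bookkeeping `ennreal_one_le_three_halves`, `ennreal_three_halves_ne_top`). The Helmholtz
decompositions already in the tree — fixed-time `Torus.smooth_helmholtz_holds`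
(`TorusLerayHelmholtzProofs`) and the jointly smooth space–time form `Torus.helmholtzPotential`,
`Torus.isSmoothSpaceTimeOn_helmholtzPotential` (`TorusLerayHelmholtzSpaceTime`) — are not used: the
explicit `Δ⁻¹ div` potential gives the decomposition jointly smooth in `(t, x)` together with
`w(t) = 0` wherever `ψ(t) = 0`, which is what the support bookkeeping below needs. The small
lemmas `divergence_zero_field`, `gradient_zero_fun` and `laplacian_zero_fun_eq`,
`contDiff_stLift_timeDeriv_of_contDiff` restate `Torus.divergence_zero`, `Torus.gradient_zero`
(`FluidPDE/EulerReynolds`), `Torus.laplacian_zero` (`TorusForceBookkeeping`) and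
`Torus.contDiff_stLift_timeDeriv` (`FluidPDE/FractionalNSReynoldsWeakIdentity`), which lie
outside this file's import closure.

## References

* J. Duchon, R. Robert, *Inertial energy dissipation for weak solutions of incompressible Euler
  and Navier–Stokes equations*, Nonlinearity 13 (2000) 249–255, proof of Prop. 1 (pp. 250–251).
  [DuchonRobert2000]
* J. C. Robinson, J. L. Rodrigo, W. Sadowski, *The Three-Dimensional Navier–Stokes Equations:
  Classical Theory*, CUP 2016: §5.1, Lemma 5.1, (5.3)–(5.10) (p. 88); §5.2, Prop. 5.3 and its
  proof (pp. 89–90); App. B, Thm. B.7 (pp. 385–386). [RobinsonRodrigoSadowskiCUP2016]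
-/

noncomputable section

open MeasureTheory Set Filter Topology Function UnitAddTorus
open scoped ENNReal NNReal Convolution ContDiff InnerProductSpace

namespace Literature.Analysis.FluidPDE.Torus

open Literature.Analysis.FunctionSpaces Literature.Analysis.FunctionSpaces.Torus

section TestDecomposition

variable {d : Type*} [Fintype d] [DecidableEq d]
variable {F : Type*} [NormedAddCommGroup F] [NormedSpace ℝ F]

/-! ## Space–time calculus complements: Schwarz in `(t, x)` on the torus -/

omit [DecidableEq d] in
/-- A field with smooth space–time lift, read on `ℝ × ℝ^d`, is jointly smooth in the sense of
`FluidPDE.IsSmoothSpaceTimeOn univ`. [folklore] -/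
theorem isSmoothSpaceTimeOn_euclid_of_contDiff {φ : ℝ → UnitAddTorus d → F} (hφ : ContDiff ℝ ∞ (stLift φ)) :
    FluidPDE.IsSmoothSpaceTimeOn univ (fun s (y : EuclideanSpace ℝ d) => φ s (proj y)) := by
  have h : uncurry (fun s (y : EuclideanSpace ℝ d) => φ s (proj y)) = stLift φ := by
    funext z; rfl
  rw [FluidPDE.IsSmoothSpaceTimeOn, h, univ_prod_univ]
  exact hφ.contDiffOn

omit [DecidableEq d] in
/-- The time derivative of a field with smooth space–time lift has smooth space–time lift
(as in `IsSpaceTimeTest.timeDeriv`). [folklore] -/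
theorem contDiff_stLift_timeDeriv_of_contDiff {φ : ℝ → UnitAddTorus d → F} (hφ : ContDiff ℝ ∞ (stLift φ)) :
    ContDiff ℝ ∞ (stLift (Torus.timeDeriv φ)) := by
  rw [stLift_timeDeriv]
  refine ContDiff.fderiv_apply (m := ∞)
    (f := fun (p : ℝ × EuclideanSpace ℝ d) (τ : ℝ) => stLift φ (τ, p.2)) ?_ contDiff_fst
    contDiff_const (le_of_eq rfl)
  exact hφ.comp (contDiff_snd.prodMk (contDiff_snd.comp contDiff_fst))

omit [DecidableEq d] in
/-- Time slices `s ↦ φ s x` of a field with smooth space–time lift are differentiable. [folklore] -/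
theorem differentiableAt_time_slice {φ : ℝ → UnitAddTorus d → F} (hφ : ContDiff ℝ ∞ (stLift φ))
    (t : ℝ) (x : UnitAddTorus d) : DifferentiableAt ℝ (fun s => φ s x) t := by
  obtain ⟨y, rfl⟩ := proj_surjective x
  have h : (fun s => φ s (proj y)) = stLift φ ∘ fun s : ℝ => (s, y) := by funext s; rfl
  rw [h]
  exact ((hφ.differentiable (by simp)).comp ((contDiff_prodMk_left y (n := ∞)).differentiable (by simp))).differentiableAt

omit [DecidableEq d] in
/-- Slices of a field with smooth space–time lift are smooth. [folklore] -/
theorem isSmooth_slice_of_contDiff {φ : ℝ → UnitAddTorus d → F} (hφ : ContDiff ℝ ∞ (stLift φ)) (s : ℝ) :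
    IsSmooth (φ s) :=
  (hφ.comp (contDiff_prodMk_right s) : IsSmooth (φ s))

omit [DecidableEq d] in
/-- Spatial partial derivatives of a field with smooth space–time lift have smooth space–time
lift. [folklore] -/
theorem contDiff_stLift_partialDeriv [DecidableEq d] {φ : ℝ → UnitAddTorus d → F}
    (hφ : ContDiff ℝ ∞ (stLift φ)) (i : d) :
    ContDiff ℝ ∞ (stLift fun s => Torus.partialDeriv i (φ s)) := by
  have h := (isSmoothSpaceTimeOn_of_contDiff hφ univ).partialDeriv uniqueDiffOn_univ i
  rw [Torus.IsSmoothSpaceTimeOn, univ_prod_univ] at h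
  exact contDiffOn_univ.1 h

/-- **Schwarz in space–time on the torus**: for a field with smooth space–time lift, the time
derivative commutes with spatial partial derivatives, `∂ₜ(∂ᵢφ) = ∂ᵢ(∂ₜφ)` (both are values of the
symmetric second derivative of the lift; via the tree's Euclidean
`FluidPDE.IsSmoothSpaceTimeOn.timeDerivWithin_fderiv_slice_apply`). [folklore] -/
theorem timeDeriv_partialDeriv_comm {φ : ℝ → UnitAddTorus d → F} (hφ : ContDiff ℝ ∞ (stLift φ)) (i : d)
    (t : ℝ) (x : UnitAddTorus d) :
    Torus.timeDeriv (fun s => Torus.partialDeriv i (φ s)) t x = Torus.partialDeriv i (Torus.timeDeriv φ t) x := by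
  obtain ⟨y, rfl⟩ := proj_surjective x
  set w : ℝ → EuclideanSpace ℝ d → F := fun s y => φ s (proj y) with hw_def
  have hw : FluidPDE.IsSmoothSpaceTimeOn univ w := isSmoothSpaceTimeOn_euclid_of_contDiff hφ
  have key := hw.timeDerivWithin_fderiv_slice_apply uniqueDiffOn_univ (by simp) (mem_univ t) y
    (EuclideanSpace.single i (1 : ℝ))
  have h1 : ∀ s, IsContDiff 1 (φ s) := fun s => (isSmooth_slice_of_contDiff hφ s).isContDiff (by simp)
  have h1' : IsContDiff 1 (Torus.timeDeriv φ t) :=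
    (isSmooth_slice_of_contDiff (contDiff_stLift_timeDeriv_of_contDiff hφ) t).isContDiff (by simp)
  -- left-hand side
  have eL : Torus.timeDeriv (fun s => Torus.partialDeriv i (φ s)) t (proj y) =
      FluidPDE.timeDerivWithin univ (fun s y => _root_.fderiv ℝ (w s) y (EuclideanSpace.single i 1)) t y := by
    rw [FluidPDE.timeDerivWithin, derivWithin_univ, Torus.timeDeriv]
    congr 1
    funext s
    rw [partialDeriv_eq_fderiv_apply (h1 s), ← fderiv_lift]
    rfl
  -- right-hand side
  have eR : Torus.partialDeriv i (Torus.timeDeriv φ t) (proj y) =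
      _root_.fderiv ℝ (FluidPDE.timeDerivWithin univ w t) y (EuclideanSpace.single i 1) := by
    rw [partialDeriv_eq_fderiv_apply h1', ← fderiv_lift]
    congr 2
    funext y'
    rw [FluidPDE.timeDerivWithin, derivWithin_univ]
    rfl
  rw [eL, eR, key]

/-- **Schwarz for the gradient**: `∂ₜ(∇φ) = ∇(∂ₜφ)` for a scalar field with smooth space–time
lift. [folklore] -/
theorem timeDeriv_gradient_comm {φ : ℝ → UnitAddTorus d → ℝ} (hφ : ContDiff ℝ ∞ (stLift φ)) (t : ℝ)
    (x : UnitAddTorus d) :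
    Torus.timeDeriv (fun s => Torus.gradient (φ s)) t x = Torus.gradient (Torus.timeDeriv φ t) x := by
  have h1 : ∀ s, IsContDiff 1 (φ s) := fun s => (isSmooth_slice_of_contDiff hφ s).isContDiff (by simp)
  have h1' : IsContDiff 1 (Torus.timeDeriv φ t) :=
    (isSmooth_slice_of_contDiff (contDiff_stLift_timeDeriv_of_contDiff hφ) t).isContDiff (by simp)
  have hdi : ∀ i, DifferentiableAt ℝ (fun s => Torus.partialDeriv i (φ s) x) t := fun i =>
    differentiableAt_time_slice (contDiff_stLift_partialDeriv hφ i) t x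
  rw [Torus.timeDeriv, gradient_eq_sum_partialDeriv h1']
  have e : (fun s => Torus.gradient (φ s) x) =
      fun s => ∑ i, Torus.partialDeriv i (φ s) x • EuclideanSpace.single i (1 : ℝ) := by
    funext s; exact gradient_eq_sum_partialDeriv (h1 s) x
  rw [e, deriv_fun_sum fun i _ => (hdi i).smul_const _]
  refine Finset.sum_congr rfl fun i _ => ?_
  rw [deriv_smul_const (hdi i), ← timeDeriv_partialDeriv_comm hφ i t x]
  rfl

/-! ## Vector Laplacian of a gradient, Hessian quadratic form -/

omit [DecidableEq d] in
/-- Coordinates of the vector Laplacian: `(Δv)ⱼ = Δ(vⱼ)` for a smooth field (the Laplacian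
commutes with the coordinate functionals). [folklore] -/
theorem laplacian_apply_coord {v : UnitAddTorus d → EuclideanSpace ℝ d} (hv : IsSmooth v) (x : UnitAddTorus d)
    (j : d) : Torus.laplacian v x j = Torus.laplacian (fun y => v y j) x := by
  have h2 : ContDiffAt ℝ 2 (liftAt v x) 0 := ((hv.liftAt x).of_le (WithTop.coe_le_coe.mpr le_top)).contDiffAt
  have key := h2.laplacian_CLM_comp_left (l := (EuclideanSpace.proj j : EuclideanSpace ℝ d →L[ℝ] ℝ))
  have hl : liftAt (fun y => v y j) x = (EuclideanSpace.proj j : EuclideanSpace ℝ d →L[ℝ] ℝ) ∘ liftAt v x := rfl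
  simp only [Torus.laplacian, hl, key, comp_apply]
  rfl

/-- **`Δ∇φ = ∇Δφ`** for smooth scalar `φ` on the torus (coordinates: `Δ∂ⱼφ = ∂ⱼΔφ`). [folklore] -/
theorem laplacian_gradient {φ : UnitAddTorus d → ℝ} (hφ : IsSmooth φ) (x : UnitAddTorus d) :
    Torus.laplacian (Torus.gradient φ) x = Torus.gradient (Torus.laplacian φ) x := by
  ext j
  rw [laplacian_apply_coord hφ.gradient x j, gradient_apply (hφ.laplacian.isContDiff (by simp)) x j,
    partialDeriv_laplacian hφ j x]
  congr 1
  funext y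
  exact gradient_apply (hφ.isContDiff (by simp)) y j

/-- `div ∇φ = Δφ` for smooth scalar `φ` on the torus. [folklore] -/
theorem divergence_gradient_eq_laplacian {φ : UnitAddTorus d → ℝ} (hφ : IsSmooth φ) (x : UnitAddTorus d) :
    Torus.divergence (Torus.gradient φ) x = Torus.laplacian φ x := by
  rw [Torus.divergence, laplacian_eq_sum_partialDeriv_partialDeriv hφ]
  refine Finset.sum_congr rfl fun i _ => ?_
  congr 1
  funext y
  exact gradient_apply (hφ.isContDiff (by simp)) y i

omit [DecidableEq d] in
/-- The real inner product on `ℝ^d` in coordinates (local copy of the tree's `inner_eq_sum_mul`). [folklore] -/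
private theorem inner_eq_sum_mul_coord (a b : EuclideanSpace ℝ d) : ⟪a, b⟫_ℝ = ∑ i, a i * b i := by
  rw [PiLp.inner_apply]
  refine Finset.sum_congr rfl fun i _ => ?_
  simp [mul_comm]

/-- `⟪a, (u·∇)∇φ⟫ = ∑ⱼ∑ᵢ aⱼ uᵢ ∂ᵢ∂ⱼφ` (the Hessian quadratic form in coordinates). [folklore] -/
theorem inner_convect_gradient {φ : UnitAddTorus d → ℝ} (hφ : IsSmooth φ)
    (a : EuclideanSpace ℝ d) (u : UnitAddTorus d → EuclideanSpace ℝ d) (x : UnitAddTorus d) :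
    ⟪a, Torus.convect u (Torus.gradient φ) x⟫_ℝ =
      ∑ j, ∑ i, a j * u x i * Torus.partialDeriv i (Torus.partialDeriv j φ) x := by
  have hG : IsContDiff 1 (Torus.gradient φ) := hφ.gradient.isContDiff (by simp)
  have hj : ∀ j, (fun y => Torus.gradient φ y j) = Torus.partialDeriv j φ := fun j =>
    funext fun y => gradient_apply (hφ.isContDiff (by simp)) y j
  rw [inner_eq_sum_mul_coord]
  refine Finset.sum_congr rfl fun j _ => ?_
  rw [Torus.convect, ← fderiv_apply_coord hG x (u x) j, hj j,
    fderiv_apply_eq_sum_partialDeriv ((hφ.partialDeriv j).isContDiff (by simp)), Finset.mul_sum]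
  refine Finset.sum_congr rfl fun i _ => ?_
  rw [smul_eq_mul]
  ring

end TestDecomposition

end Literature.Analysis.FluidPDE.Torus

namespace Literature.Analysis.FluidPDE.Torus

open Literature.Analysis.FunctionSpaces Literature.Analysis.FunctionSpaces.Torus

/-! ## The Helmholtz decomposition of a space–time test field -/

section Helmholtz

variable {d : Type*} [Fintype d] [DecidableEq d]

/-- **The potential of a vector test field**: `φ(t) := Δ⁻¹ div ψ(t)` (Robinson–Rodrigo–Sadowski
2016, proof of Prop. 5.3: "`φ = ϕ + ∇ψ`" via Thm. 2.6; here with the tree's `Torus.invLaplacian`). [folklore] -/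
def testPotential (ψ : ℝ → UnitAddTorus d → EuclideanSpace ℝ d) (t : ℝ) : UnitAddTorus d → ℝ :=
  invLaplacian (Torus.divergence (ψ t))

/-- **The solenoidal part of a vector test field**: `w(t) := ψ(t) - ∇φ(t)`. [folklore] -/
def testSolenoidal (ψ : ℝ → UnitAddTorus d → EuclideanSpace ℝ d) (t : ℝ) (x : UnitAddTorus d) :
    EuclideanSpace ℝ d :=
  ψ t x - Torus.gradient (testPotential ψ t) x

variable {ψ : ℝ → UnitAddTorus d → EuclideanSpace ℝ d}

omit [Fintype d] [DecidableEq d] in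
/-- Partial derivatives of constants vanish. [folklore] -/
theorem partialDeriv_const_eq_zero [Fintype d] [DecidableEq d] {F : Type*} [NormedAddCommGroup F] [NormedSpace ℝ F]
    (c : F) (i : d) (x : UnitAddTorus d) : Torus.partialDeriv i (fun _ : UnitAddTorus d => c) x = 0 := by
  simp [Torus.partialDeriv, Torus.lineDeriv]

/-- The divergence of the zero field vanishes. [folklore] -/
theorem divergence_zero_field : Torus.divergence (0 : UnitAddTorus d → EuclideanSpace ℝ d) = fun _ => 0 := by
  funext x
  simp only [Torus.divergence, Pi.zero_apply, PiLp.zero_apply]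
  exact Finset.sum_eq_zero fun i _ => partialDeriv_const_eq_zero (0 : ℝ) i x

/-- The Laplacian of the zero function vanishes. [folklore] -/
theorem laplacian_zero_fun_eq {F : Type*} [NormedAddCommGroup F] [NormedSpace ℝ F] :
    Torus.laplacian (fun _ : UnitAddTorus d => (0 : F)) = fun _ => 0 := by
  funext x
  rw [laplacian_eq_sum_partialDeriv_partialDeriv (isSmooth_const (0 : F))]
  refine Finset.sum_eq_zero fun i _ => ?_
  have h : Torus.partialDeriv i (fun _ : UnitAddTorus d => (0 : F)) = fun _ => 0 :=
    funext (partialDeriv_const_eq_zero (0 : F) i)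
  rw [h, partialDeriv_const_eq_zero]

/-- `Δ⁻¹ 0 = 0`. [folklore] -/
theorem invLaplacian_zero_fun : invLaplacian (fun _ : UnitAddTorus d => (0 : ℝ)) = fun _ => 0 := by
  have hit : ∀ n : ℕ, Torus.laplacian^[n] (fun _ : UnitAddTorus d => (0 : ℝ)) = fun _ => 0 := by
    intro n
    induction n with
    | zero => rfl
    | succ n ih => rw [iterate_succ_apply', ih, laplacian_zero_fun_eq]
  rw [invLaplacian, hit]
  have h0 : (fun _ : UnitAddTorus d => (0 : ℝ)) = 0 := rfl
  rw [h0, convolution_zero, smul_zero]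

/-- The gradient of the zero function vanishes. [folklore] -/
theorem gradient_zero_fun (x : UnitAddTorus d) : Torus.gradient (fun _ : UnitAddTorus d => (0 : ℝ)) x = 0 := by
  rw [gradient_eq_sum_partialDeriv ((isSmooth_const (0 : ℝ)).isContDiff (by simp))]
  simp [partialDeriv_const_eq_zero]

/-- The potential vanishes where the test field does. [folklore] -/
theorem testPotential_eq_zero {t : ℝ} (h : ψ t = 0) : testPotential ψ t = fun _ => 0 := by
  rw [testPotential, h, divergence_zero_field, invLaplacian_zero_fun]

/-- The solenoidal part vanishes where the test field does. [folklore] -/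
theorem testSolenoidal_eq_zero {t : ℝ} (h : ψ t = 0) : testSolenoidal ψ t = 0 := by
  funext x
  rw [testSolenoidal, testPotential_eq_zero h, gradient_zero_fun, h]
  simp

/-- The potential has smooth space–time lift (`Torus.IsSmoothSpaceTimeOn.invLaplacian`). [folklore] -/
theorem contDiff_stLift_testPotential (hψ : ContDiff ℝ ∞ (stLift ψ)) :
    ContDiff ℝ ∞ (stLift (testPotential ψ)) := by
  have hs : Torus.IsSmoothSpaceTimeOn univ ψ := isSmoothSpaceTimeOn_of_contDiff hψ univ
  have h := (hs.divergence uniqueDiffOn_univ).invLaplacian convex_univ (by simp)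
  rw [Torus.IsSmoothSpaceTimeOn, univ_prod_univ] at h
  exact contDiffOn_univ.1 h

/-- The gradient of the potential has smooth space–time lift. [folklore] -/
theorem contDiff_stLift_gradient_testPotential (hψ : ContDiff ℝ ∞ (stLift ψ)) :
    ContDiff ℝ ∞ (stLift fun t => Torus.gradient (testPotential ψ t)) := by
  have h := (isSmoothSpaceTimeOn_of_contDiff (contDiff_stLift_testPotential hψ) univ).gradient
    uniqueDiffOn_univ
  rw [Torus.IsSmoothSpaceTimeOn, univ_prod_univ] at h
  exact contDiffOn_univ.1 h

/-- The solenoidal part has smooth space–time lift. [folklore] -/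
theorem contDiff_stLift_testSolenoidal (hψ : ContDiff ℝ ∞ (stLift ψ)) :
    ContDiff ℝ ∞ (stLift (testSolenoidal ψ)) :=
  hψ.sub (contDiff_stLift_gradient_testPotential hψ)

/-- The solenoidal part of a test field supported in `(0, T)` is a test field supported in
`(0, T)`. [folklore] -/
theorem isSpaceTimeTestIoo_testSolenoidal {T : ℝ} (hψ : IsSpaceTimeTestIoo T ψ) :
    IsSpaceTimeTestIoo T (testSolenoidal ψ) := by
  obtain ⟨⟨hs, T', hT', h0⟩, ε, hε, hε0⟩ := hψ
  exact ⟨⟨contDiff_stLift_testSolenoidal hs, T', hT', fun t ht => testSolenoidal_eq_zero (h0 t ht)⟩,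
    ε, hε, fun t ht => testSolenoidal_eq_zero (hε0 t ht)⟩

/-- **The solenoidal part is divergence free**: `div(ψ - ∇Δ⁻¹div ψ) = div ψ - (div ψ - ∫div ψ) = 0`
(`d` nonempty; `∫ div ψ = 0`). [folklore] -/
theorem isDivFreeTest_testSolenoidal [Nonempty d] (hψ : ContDiff ℝ ∞ (stLift ψ)) :
    IsDivFreeTest (testSolenoidal ψ) := by
  intro t x
  have hψt : IsSmooth (ψ t) := isSmooth_slice_of_contDiff hψ t
  have hdiv : IsSmooth (Torus.divergence (ψ t)) := hψt.divergence
  have hφ : IsSmooth (testPotential ψ t) := isSmooth_invLaplacian hdiv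
  have e : testSolenoidal ψ t = ψ t - Torus.gradient (testPotential ψ t) := rfl
  rw [e, divergence_sub (hψt.isContDiff (by simp)) (hφ.gradient.isContDiff (by simp)),
    divergence_gradient_eq_laplacian hφ, testPotential, laplacian_invLaplacian hdiv,
    integral_divergence_eq_zero_holds hψt]
  ring

end Helmholtz

/-! ## Slice integrability -/

section SliceIntegrability

variable {d : Type*} [Fintype d] [DecidableEq d]
variable {v : UnitAddTorus d → EuclideanSpace ℝ d}

omit [DecidableEq d] in
/-- `⟪v, V⟫ ∈ L¹(T^d)` for `v ∈ L²` and continuous `V`. [folklore] -/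
theorem integrable_inner_continuous_of_memLp_two (hv : MemLp v 2 volume) {V : UnitAddTorus d → EuclideanSpace ℝ d}
    (hV : Continuous V) : Integrable (fun x => ⟪v x, V x⟫_ℝ) volume := by
  obtain ⟨C, hC⟩ := exists_forall_norm_le_of_continuous hV
  refine Integrable.mono' ((hv.integrable one_le_two).norm.mul_const C)
    (hv.1.inner hV.aestronglyMeasurable) (ae_of_all _ fun x => ?_)
  rw [Real.norm_eq_abs]
  exact (abs_real_inner_le_norm _ _).trans (mul_le_mul_of_nonneg_left (hC x) (norm_nonneg _))

/-- `⟪v, (v·∇)Φ⟫ ∈ L¹(T^d)` for `v ∈ L²` and a `C¹` field `Φ` (`|⟪v, DΦ(x)v⟫| ≤ ‖DΦ‖_∞ ‖v‖²`). [folklore] -/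
theorem integrable_inner_convect_of_memLp_two (hv : MemLp v 2 volume)
    {Φ : UnitAddTorus d → EuclideanSpace ℝ d} (hΦ : IsContDiff 1 Φ) :
    Integrable (fun x => ⟪v x, Torus.convect v Φ x⟫_ℝ) volume := by
  have hcont : Continuous (Torus.fderiv Φ) := hΦ.continuous_fderiv
  obtain ⟨C, hC⟩ := exists_forall_norm_le_of_continuous hcont
  have hsq : Integrable (fun x => ‖v x‖ ^ 2) volume := (memLp_two_iff_integrable_sq_norm hv.1).1 hv
  have hmi : ∀ k, AEStronglyMeasurable (fun x => v x k) volume := fun k =>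
    (EuclideanSpace.proj k : EuclideanSpace ℝ d →L[ℝ] ℝ).continuous.comp_aestronglyMeasurable hv.1
  have hmeas : AEStronglyMeasurable (fun x => ⟪v x, Torus.convect v Φ x⟫_ℝ) volume := by
    have e : (fun x => ⟪v x, Torus.convect v Φ x⟫_ℝ) =
        fun x => ⟪v x, ∑ i, v x i • Torus.partialDeriv i Φ x⟫_ℝ := by
      funext x; rw [Torus.convect, fderiv_apply_eq_sum_partialDeriv hΦ]
    rw [e]
    refine hv.1.inner (Finset.aestronglyMeasurable_fun_sum _ fun i _ => (hmi i).smul ?_)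
    have hc : Continuous fun x => Torus.fderiv Φ x (EuclideanSpace.single i (1 : ℝ)) :=
      hΦ.continuous_fderiv.clm_apply continuous_const
    refine hc.aestronglyMeasurable.congr (ae_of_all _ fun x => ?_)
    exact (partialDeriv_eq_fderiv_apply hΦ i x).symm
  refine Integrable.mono' (hsq.mul_const C) hmeas (ae_of_all _ fun x => ?_)
  rw [Real.norm_eq_abs, Torus.convect]
  calc |⟪v x, Torus.fderiv Φ x (v x)⟫_ℝ| ≤ ‖v x‖ * ‖Torus.fderiv Φ x (v x)‖ := abs_real_inner_le_norm _ _
    _ ≤ ‖v x‖ * (‖Torus.fderiv Φ x‖ * ‖v x‖) :=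
        mul_le_mul_of_nonneg_left (ContinuousLinearMap.le_opNorm _ _) (norm_nonneg _)
    _ ≤ ‖v x‖ * (C * ‖v x‖) := by gcongr; exact hC x
    _ = ‖v x‖ ^ 2 * C := by ring

omit [DecidableEq d] in
/-- `vᵢvⱼ g ∈ L¹(T^d)` for `v ∈ L²` and continuous `g`. [folklore] -/
theorem integrable_coord_mul_coord_mul (hv : MemLp v 2 volume) (i j : d) {g : UnitAddTorus d → ℝ}
    (hg : Continuous g) : Integrable (fun x => v x i * v x j * g x) volume := by
  obtain ⟨C, hC⟩ := exists_forall_norm_le_of_continuous hg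
  have hsq : Integrable (fun x => ‖v x‖ ^ 2) volume := (memLp_two_iff_integrable_sq_norm hv.1).1 hv
  have hmi : ∀ k, AEStronglyMeasurable (fun x => v x k) volume := fun k =>
    (EuclideanSpace.proj k : EuclideanSpace ℝ d →L[ℝ] ℝ).continuous.comp_aestronglyMeasurable hv.1
  refine Integrable.mono' (hsq.mul_const C) (((hmi i).mul (hmi j)).mul hg.aestronglyMeasurable)
    (ae_of_all _ fun x => ?_)
  rw [Real.norm_eq_abs, abs_mul, abs_mul]
  have hi : |v x i| ≤ ‖v x‖ := by simpa using PiLp.norm_apply_le (v x) i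
  have hj : |v x j| ≤ ‖v x‖ := by simpa using PiLp.norm_apply_le (v x) j
  have hg' : |g x| ≤ C := by simpa [Real.norm_eq_abs] using hC x
  calc |v x i| * |v x j| * |g x| ≤ ‖v x‖ * ‖v x‖ * C :=
        mul_le_mul (mul_le_mul hi hj (abs_nonneg _) (norm_nonneg _)) hg' (abs_nonneg _)
          (mul_nonneg (norm_nonneg _) (norm_nonneg _))
    _ = ‖v x‖ ^ 2 * C := by ring

end SliceIntegrability

end Literature.Analysis.FluidPDE.Torus

namespace Literature.Analysis.FluidPDE.Torus

open Literature.Analysis.FunctionSpaces Literature.Analysis.FunctionSpaces.Torus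

section Distributional

variable {d : Type*} [Fintype d] [DecidableEq d]

/-- **The gradient part of a test field tests to zero against `(u, P)`**: for `v ∈ L²(T^d)`
weakly divergence free, `q ∈ L¹(T^d)` solving `Δq = -∂ᵢ∂ⱼ(vᵢvⱼ)` very weakly, and a scalar `φ`
with smooth space–time lift,
`∫ (⟪v, ∂ₜ∇φ⟫ + ⟪v, (v·∇)∇φ⟫ + ν⟪v, Δ∇φ⟫ + q Δφ) dx = 0` at every time:
`∂ₜ∇φ = ∇∂ₜφ` and `Δ∇φ = ∇Δφ` are gradients (weak divergence-freeness), and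
`∫ ⟪v, (v·∇)∇φ⟫ = ∑ᵢⱼ ∫ vᵢvⱼ∂ᵢ∂ⱼφ = -∫ q Δφ` (Robinson–Rodrigo–Sadowski 2016, proof of Prop. 5.3). [cite: RobinsonRodrigoSadowskiCUP2016, Prop. 5.3 (pp. 89–90)] -/
theorem integral_gradientPart_eq_zero [Nonempty d] {φ : ℝ → UnitAddTorus d → ℝ} (hφ : ContDiff ℝ ∞ (stLift φ))
    (ν : ℝ) {v : UnitAddTorus d → EuclideanSpace ℝ d} (hv : MemLp v 2 volume) (hdiv : Torus.IsWeaklyDivFree v)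
    {q : UnitAddTorus d → ℝ} (hq : Integrable q volume)
    (hPois : ∀ θ : UnitAddTorus d → ℝ, IsSmooth θ → ∫ x, q x * Torus.laplacian θ x =
      -∑ i, ∑ j, ∫ x, (v x i * v x j) * Torus.partialDeriv i (Torus.partialDeriv j θ) x) (t : ℝ) :
    ∫ x, (⟪v x, Torus.timeDeriv (fun s => Torus.gradient (φ s)) t x⟫_ℝ +
        ⟪v x, Torus.convect v (Torus.gradient (φ t)) x⟫_ℝ +
        ν * ⟪v x, Torus.laplacian (Torus.gradient (φ t)) x⟫_ℝ + q x * Torus.laplacian (φ t) x) = 0 := by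
  have hφt : IsSmooth (φ t) := isSmooth_slice_of_contDiff hφ t
  have hφ' : IsSmooth (Torus.timeDeriv φ t) := isSmooth_slice_of_contDiff (contDiff_stLift_timeDeriv_of_contDiff hφ) t
  -- the four terms
  have e1 : (fun x => ⟪v x, Torus.timeDeriv (fun s => Torus.gradient (φ s)) t x⟫_ℝ) =
      fun x => ⟪v x, Torus.gradient (Torus.timeDeriv φ t) x⟫_ℝ := by
    funext x; rw [timeDeriv_gradient_comm hφ t x]
  have e3 : (fun x => ν * ⟪v x, Torus.laplacian (Torus.gradient (φ t)) x⟫_ℝ) =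
      fun x => ν * ⟪v x, Torus.gradient (Torus.laplacian (φ t)) x⟫_ℝ := by
    funext x; rw [laplacian_gradient hφt x]
  have e2 : (fun x => ⟪v x, Torus.convect v (Torus.gradient (φ t)) x⟫_ℝ) =
      fun x => ∑ j, ∑ i, v x i * v x j * Torus.partialDeriv i (Torus.partialDeriv j (φ t)) x := by
    funext x
    rw [inner_convect_gradient hφt (v x) v x]
    refine Finset.sum_congr rfl fun j _ => Finset.sum_congr rfl fun i _ => ?_
    ring
  have hI1 : Integrable (fun x => ⟪v x, Torus.timeDeriv (fun s => Torus.gradient (φ s)) t x⟫_ℝ) volume := by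
    rw [e1]; exact integrable_inner_continuous_of_memLp_two hv hφ'.gradient.continuous
  have hI2 : Integrable (fun x => ⟪v x, Torus.convect v (Torus.gradient (φ t)) x⟫_ℝ) volume :=
    integrable_inner_convect_of_memLp_two hv (hφt.gradient.isContDiff (by simp))
  have hI3 : Integrable (fun x => ν * ⟪v x, Torus.laplacian (Torus.gradient (φ t)) x⟫_ℝ) volume := by
    rw [e3]; exact (integrable_inner_continuous_of_memLp_two hv hφt.laplacian.gradient.continuous).const_mul ν
  have hI4 : Integrable (fun x => q x * Torus.laplacian (φ t) x) volume := by
    obtain ⟨C, hC⟩ := exists_forall_norm_le_of_continuous hφt.laplacian.continuous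
    exact hq.mul_bdd hφt.laplacian.continuous.aestronglyMeasurable (ae_of_all _ hC)
  have hI12 : Integrable (fun x => ⟪v x, Torus.timeDeriv (fun s => Torus.gradient (φ s)) t x⟫_ℝ +
      ⟪v x, Torus.convect v (Torus.gradient (φ t)) x⟫_ℝ) volume := hI1.add hI2
  have hI123 : Integrable (fun x => ⟪v x, Torus.timeDeriv (fun s => Torus.gradient (φ s)) t x⟫_ℝ +
      ⟪v x, Torus.convect v (Torus.gradient (φ t)) x⟫_ℝ +
      ν * ⟪v x, Torus.laplacian (Torus.gradient (φ t)) x⟫_ℝ) volume := hI12.add hI3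
  rw [integral_add hI123 hI4, integral_add hI12 hI3, integral_add hI1 hI2]
  -- values
  have v1 : ∫ x, ⟪v x, Torus.timeDeriv (fun s => Torus.gradient (φ s)) t x⟫_ℝ = 0 := by
    rw [e1]; exact hdiv _ hφ'
  have v3 : ∫ x, ν * ⟪v x, Torus.laplacian (Torus.gradient (φ t)) x⟫_ℝ = 0 := by
    rw [e3, integral_const_mul, hdiv _ hφt.laplacian, mul_zero]
  set S : ℝ := ∑ j, ∑ i, ∫ x, v x i * v x j * Torus.partialDeriv i (Torus.partialDeriv j (φ t)) x with hS
  have hIij : ∀ i j, Integrable (fun x => v x i * v x j * Torus.partialDeriv i (Torus.partialDeriv j (φ t)) x)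
      volume := fun i j =>
    integrable_coord_mul_coord_mul hv i j (((hφt.partialDeriv j).partialDeriv i).continuous)
  have v2 : ∫ x, ⟪v x, Torus.convect v (Torus.gradient (φ t)) x⟫_ℝ = S := by
    rw [e2, integral_finsetSum _ fun j _ => integrable_finsetSum _ fun i _ => hIij i j]
    refine Finset.sum_congr rfl fun j _ => ?_
    rw [integral_finsetSum _ fun i _ => hIij i j]
  have v4 : ∫ x, q x * Torus.laplacian (φ t) x = -S := by
    rw [hPois _ hφt, hS, Finset.sum_comm]
  rw [v1, v2, v3, v4]
  ring

variable {T ν : ℝ} {u : ℝ → UnitAddTorus d → EuclideanSpace ℝ d}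

omit [DecidableEq d] in
/-- Slices of the velocity of a weak solution are a.e. in `L²(T^d)`. [folklore] -/
theorem ae_memLp_two_slice_of_isWeakNSSolutionOn [DecidableEq d] (hu : Torus.IsWeakNSSolutionOn T ν u) :
    ∀ᵐ t ∂(volume.restrict (Ioo 0 T)), MemLp (u t) 2 volume := by
  have hm : AEStronglyMeasurable (uncurry u) ((volume.restrict (Ioo 0 T)).prod volume) :=
    aestronglyMeasurable_uncurry_prod hu.1
  have hfin : ∫⁻ z, ‖u z.1 z.2‖ₑ ^ (2 : ℝ) ∂((volume.restrict (Ioo 0 T)).prod volume) < ⊤ := by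
    have h := hu.2.1
    rw [lintegral_Ioo_lintegral_eq_lintegral_prod (hm.enorm.pow_const _)] at h
    simpa only [ENNReal.rpow_two] using h
  have h := ae_memLp_of_lintegral_prod_rpow_lt_top hm zero_lt_two hfin
  simpa only [ENNReal.ofReal_ofNat] using h

omit [Fintype d] [DecidableEq d] in
/-- Slices of an `L¹` function on `(0,T) × T^d` are a.e. integrable. [folklore] -/
theorem ae_integrable_slice_of_lintegral [Fintype d] {P : ℝ → UnitAddTorus d → ℝ}
    (hPm : AEStronglyMeasurable (uncurry P) ((volume.restrict (Ioo 0 T)).prod volume))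
    (hP1 : ∫⁻ t in Ioo 0 T, ∫⁻ x, ‖P t x‖ₑ < ⊤) :
    ∀ᵐ t ∂(volume.restrict (Ioo 0 T)), Integrable (P t) volume := by
  have hfin : ∫⁻ z, ‖P z.1 z.2‖ₑ ^ (1 : ℝ) ∂((volume.restrict (Ioo 0 T)).prod volume) < ⊤ := by
    rw [lintegral_Ioo_lintegral_eq_lintegral_prod hPm.enorm] at hP1
    simpa only [ENNReal.rpow_one] using hP1
  have h := ae_memLp_of_lintegral_prod_rpow_lt_top hPm zero_lt_one hfin
  filter_upwards [h] with t ht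
  rw [ENNReal.ofReal_one] at ht
  exact memLp_one_iff_integrable.1 ht

/-- **Weak solutions with a very weak pressure are distributional solutions** (Robinson–Rodrigo–
Sadowski 2016, Prop. 5.3, on `T^d`): let `u` be a (pressure-free) weak Navier–Stokes/Euler solution
on `T^d × (0,T)` (`Torus.IsWeakNSSolutionOn`: tested against divergence-free fields) and let
`P ∈ L¹((0,T) × T^d)` satisfy, for a.e. `t`, `∫ P(t) Δθ = -∑ᵢⱼ ∫ uᵢuⱼ(t) ∂ᵢ∂ⱼθ` for all smooth
`θ`. Then `(u, P)` solves the equations against **all** smooth vector test fields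
(`Torus.IsDistributionalNSSolutionOn`, unforced). Proof as printed: split a test field
`ψ = w + ∇φ`, `φ = Δ⁻¹div ψ` (`Torus.testPotential`), `w` divergence free
(`Torus.testSolenoidal`); `w` is admissible in the weak formulation, and the gradient part tests
to zero slice-wise (`integral_gradientPart_eq_zero`). `d` nonempty. [cite: RobinsonRodrigoSadowskiCUP2016, Prop. 5.3 (pp. 89–90)] -/
theorem _root_.Literature.Analysis.FunctionSpaces.Torus.IsWeakNSSolutionOn.isDistributionalNSSolutionOn_of_pressure
    [Nonempty d] (hu : Torus.IsWeakNSSolutionOn T ν u) {P : ℝ → UnitAddTorus d → ℝ}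
    (hPm : AEStronglyMeasurable (uncurry P) ((volume.restrict (Ioo 0 T)).prod volume))
    (hP1 : ∫⁻ t in Ioo 0 T, ∫⁻ x, ‖P t x‖ₑ < ⊤)
    (hPweak : ∀ᵐ t ∂(volume.restrict (Ioo 0 T)), ∀ θ : UnitAddTorus d → ℝ, IsSmooth θ →
      ∫ x, P t x * Torus.laplacian θ x =
        -∑ i, ∑ j, ∫ x, (u t x i * u t x j) * Torus.partialDeriv i (Torus.partialDeriv j θ) x) :
    IsDistributionalNSSolutionOn T ν 0 u P := by
  refine ⟨hu.1, hu.2.1, aestronglyMeasurable_stLift_of_uncurry hPm, hP1, hu.2.2.1, fun ψ hψ => ?_⟩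
  have hψs : ContDiff ℝ ∞ (stLift ψ) := hψ.1.1
  -- the decomposition
  set φ : ℝ → UnitAddTorus d → ℝ := testPotential ψ with hφ_def
  set w : ℝ → UnitAddTorus d → EuclideanSpace ℝ d := testSolenoidal ψ with hw_def
  have hφs : ContDiff ℝ ∞ (stLift φ) := contDiff_stLift_testPotential hψs
  have hΓs : ContDiff ℝ ∞ (stLift fun s => Torus.gradient (φ s)) := contDiff_stLift_gradient_testPotential hψs
  have hws : ContDiff ℝ ∞ (stLift w) := contDiff_stLift_testSolenoidal hψs
  have hw0 := hu.2.2.2 w (isSpaceTimeTestIoo_testSolenoidal hψ) (isDivFreeTest_testSolenoidal hψs)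
  -- slices
  have hψt : ∀ t, IsSmooth (ψ t) := isSmooth_slice_of_contDiff hψs
  have hφt : ∀ t, IsSmooth (φ t) := isSmooth_slice_of_contDiff hφs
  have hwt : ∀ t, IsSmooth (w t) := isSmooth_slice_of_contDiff hws
  -- pointwise identities
  have hw_apply : ∀ t x, w t x = ψ t x - Torus.gradient (φ t) x := fun t x => rfl
  have eT : ∀ t x, Torus.timeDeriv ψ t x =
      Torus.timeDeriv w t x + Torus.timeDeriv (fun s => Torus.gradient (φ s)) t x := by
    intro t x
    have hd1 : DifferentiableAt ℝ (fun s => ψ s x) t := differentiableAt_time_slice hψs t x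
    have hd2 : DifferentiableAt ℝ (fun s => Torus.gradient (φ s) x) t := differentiableAt_time_slice hΓs t x
    have e : (fun s => w s x) = fun s => ψ s x - Torus.gradient (φ s) x := funext fun s => hw_apply s x
    show deriv (fun s => ψ s x) t = deriv (fun s => w s x) t + deriv (fun s => Torus.gradient (φ s) x) t
    rw [e, deriv_fun_sub hd1 hd2]
    abel
  have eC : ∀ t x, Torus.convect (u t) (ψ t) x =
      Torus.convect (u t) (w t) x + Torus.convect (u t) (Torus.gradient (φ t)) x := by
    intro t x
    have e : w t = ψ t - Torus.gradient (φ t) := rfl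
    simp only [Torus.convect]
    rw [e, fderiv_sub ((hψt t).isContDiff (by simp)) ((hφt t).gradient.isContDiff (by simp)),
      FunLike.coe_sub, Pi.sub_apply]
    abel
  have eL : ∀ t x, Torus.laplacian (ψ t) x =
      Torus.laplacian (w t) x + Torus.laplacian (Torus.gradient (φ t)) x := by
    intro t x
    have e : w t = fun y => ψ t y - Torus.gradient (φ t) y := rfl
    rw [e, laplacian_fun_sub_apply (hψt t) (hφt t).gradient]
    abel
  have eD : ∀ t x, Torus.divergence (ψ t) x = Torus.laplacian (φ t) x := by
    intro t x
    have h0 := isDivFreeTest_testSolenoidal hψs t x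
    have e : testSolenoidal ψ t = ψ t - Torus.gradient (φ t) := rfl
    rw [e, divergence_sub ((hψt t).isContDiff (by simp)) ((hφt t).gradient.isContDiff (by simp)),
      divergence_gradient_eq_laplacian (hφt t)] at h0
    linarith
  -- the integrand splits
  have hsplit : ∀ t x,
      ⟪u t x, Torus.timeDeriv ψ t x⟫_ℝ + ⟪u t x, Torus.convect (u t) (ψ t) x⟫_ℝ +
        ν * ⟪u t x, Torus.laplacian (ψ t) x⟫_ℝ + P t x * Torus.divergence (ψ t) x +
        ⟪(0 : ℝ → UnitAddTorus d → EuclideanSpace ℝ d) t x, ψ t x⟫_ℝ =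
      (⟪u t x, Torus.timeDeriv w t x⟫_ℝ + ⟪u t x, Torus.convect (u t) (w t) x⟫_ℝ +
        ν * ⟪u t x, Torus.laplacian (w t) x⟫_ℝ) +
      (⟪u t x, Torus.timeDeriv (fun s => Torus.gradient (φ s)) t x⟫_ℝ +
        ⟪u t x, Torus.convect (u t) (Torus.gradient (φ t)) x⟫_ℝ +
        ν * ⟪u t x, Torus.laplacian (Torus.gradient (φ t)) x⟫_ℝ + P t x * Torus.laplacian (φ t) x) := by
    intro t x
    rw [eT, eC, eL, eD]
    simp only [Pi.zero_apply, inner_zero_left, inner_add_right]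
    ring
  -- slice-wise: the gradient part integrates to zero and the `w` part is integrable
  have hslice : ∀ᵐ t ∂(volume.restrict (Ioo 0 T)),
      ∫ x, (⟪u t x, Torus.timeDeriv ψ t x⟫_ℝ + ⟪u t x, Torus.convect (u t) (ψ t) x⟫_ℝ +
        ν * ⟪u t x, Torus.laplacian (ψ t) x⟫_ℝ + P t x * Torus.divergence (ψ t) x +
        ⟪(0 : ℝ → UnitAddTorus d → EuclideanSpace ℝ d) t x, ψ t x⟫_ℝ) =
      ∫ x, (⟪u t x, Torus.timeDeriv w t x⟫_ℝ + ⟪u t x, Torus.convect (u t) (w t) x⟫_ℝ +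
        ν * ⟪u t x, Torus.laplacian (w t) x⟫_ℝ) := by
    filter_upwards [ae_memLp_two_slice_of_isWeakNSSolutionOn hu, hu.2.2.1,
      ae_integrable_slice_of_lintegral hPm hP1, hPweak] with t hu2 hdivt hPt hPoist
    simp_rw [hsplit t]
    have hwT : IsSmooth (Torus.timeDeriv w t) := isSmooth_slice_of_contDiff (contDiff_stLift_timeDeriv_of_contDiff hws) t
    have hIw : Integrable (fun x => ⟪u t x, Torus.timeDeriv w t x⟫_ℝ + ⟪u t x, Torus.convect (u t) (w t) x⟫_ℝ +
        ν * ⟪u t x, Torus.laplacian (w t) x⟫_ℝ) volume :=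
      ((integrable_inner_continuous_of_memLp_two hu2 hwT.continuous).add
        (integrable_inner_convect_of_memLp_two hu2 ((hwt t).isContDiff (by simp)))).add
        ((integrable_inner_continuous_of_memLp_two hu2 (hwt t).laplacian.continuous).const_mul ν)
    have hΓT : IsSmooth (Torus.timeDeriv (fun s => Torus.gradient (φ s)) t) :=
      isSmooth_slice_of_contDiff (contDiff_stLift_timeDeriv_of_contDiff hΓs) t
    have hIq : Integrable (fun x => P t x * Torus.laplacian (φ t) x) volume := by
      obtain ⟨C, hC⟩ := exists_forall_norm_le_of_continuous (hφt t).laplacian.continuous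
      exact hPt.mul_bdd (hφt t).laplacian.continuous.aestronglyMeasurable (ae_of_all _ hC)
    have hIΓ : Integrable (fun x => ⟪u t x, Torus.timeDeriv (fun s => Torus.gradient (φ s)) t x⟫_ℝ +
        ⟪u t x, Torus.convect (u t) (Torus.gradient (φ t)) x⟫_ℝ +
        ν * ⟪u t x, Torus.laplacian (Torus.gradient (φ t)) x⟫_ℝ + P t x * Torus.laplacian (φ t) x) volume :=
      (((integrable_inner_continuous_of_memLp_two hu2 hΓT.continuous).add
        (integrable_inner_convect_of_memLp_two hu2 ((hφt t).gradient.isContDiff (by simp)))).add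
        ((integrable_inner_continuous_of_memLp_two hu2 (hφt t).gradient.laplacian.continuous).const_mul ν)).add hIq
    rw [integral_add hIw hIΓ, integral_gradientPart_eq_zero hφs ν hu2 hdivt hPt hPoist t, add_zero]
  rw [integral_congr_ae hslice]
  exact hw0

end Distributional

end Literature.Analysis.FluidPDE.Torus

namespace Literature.Analysis.FluidPDE.Torus

open Literature.Analysis.FunctionSpaces Literature.Analysis.FunctionSpaces.Torus

/-! ## The velocity tensor `u ⊗ u` in `L^{3/2}` -/

section VelTensor

variable {d : Type*} [Fintype d]
variable {α : Type*} [MeasurableSpace α] {μ : Measure α}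

/-- **The velocity tensor** `(u ⊗ u)ᵢⱼ(a, x) = uᵢ(a,x) uⱼ(a,x)`, the data of the pressure Poisson
equation `-Δp = ∂ᵢ∂ⱼ(uᵢuⱼ)` (Robinson–Rodrigo–Sadowski 2016, (5.3)). [folklore] -/
def velTensor (u : α → UnitAddTorus d → EuclideanSpace ℝ d) (i j : d) (a : α) (x : UnitAddTorus d) : ℝ :=
  u a x i * u a x j

variable {u v : α → UnitAddTorus d → EuclideanSpace ℝ d}

/-- Components of a jointly measurable field are jointly measurable. [folklore] -/
theorem aestronglyMeasurable_uncurry_coord (hm : AEStronglyMeasurable (uncurry u) (μ.prod volume)) (i : d) :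
    AEStronglyMeasurable (fun z : α × UnitAddTorus d => u z.1 z.2 i) (μ.prod volume) :=
  (EuclideanSpace.proj i : EuclideanSpace ℝ d →L[ℝ] ℝ).continuous.comp_aestronglyMeasurable hm

/-- The velocity tensor of a jointly measurable field is jointly measurable. [folklore] -/
theorem aestronglyMeasurable_uncurry_velTensor (hm : AEStronglyMeasurable (uncurry u) (μ.prod volume)) (i j : d) :
    AEStronglyMeasurable (uncurry (velTensor u i j)) (μ.prod volume) :=
  (aestronglyMeasurable_uncurry_coord hm i).mul (aestronglyMeasurable_uncurry_coord hm j)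

omit [MeasurableSpace α] in
/-- `|uᵢuⱼ| ≤ ‖u‖²` in `ℝ≥0∞`-norms. [folklore] -/
theorem enorm_velTensor_le (u : α → UnitAddTorus d → EuclideanSpace ℝ d) (i j : d) (a : α) (x : UnitAddTorus d) :
    ‖velTensor u i j a x‖ₑ ≤ ‖u a x‖ₑ ^ 2 := by
  rw [velTensor, enorm_mul, sq]
  have hi : ‖u a x i‖ₑ ≤ ‖u a x‖ₑ := by
    rw [← ofReal_norm, ← ofReal_norm]
    exact ENNReal.ofReal_le_ofReal (by simpa using PiLp.norm_apply_le (u a x) i)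
  have hj : ‖u a x j‖ₑ ≤ ‖u a x‖ₑ := by
    rw [← ofReal_norm, ← ofReal_norm]
    exact ENNReal.ofReal_le_ofReal (by simpa using PiLp.norm_apply_le (u a x) j)
  exact mul_le_mul' hi hj

/-- `∫⁻ |uᵢuⱼ|^{3/2} ≤ ∫⁻ ‖u‖³`. [folklore] -/
theorem lintegral_velTensor_rpow_le (u : α → UnitAddTorus d → EuclideanSpace ℝ d) (i j : d) :
    ∫⁻ z, ‖velTensor u i j z.1 z.2‖ₑ ^ (3 / 2 : ℝ) ∂(μ.prod volume) ≤
      ∫⁻ z, ‖u z.1 z.2‖ₑ ^ (3 : ℕ) ∂(μ.prod volume) := by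
  refine lintegral_mono fun z => ?_
  calc ‖velTensor u i j z.1 z.2‖ₑ ^ (3 / 2 : ℝ) ≤ (‖u z.1 z.2‖ₑ ^ 2) ^ (3 / 2 : ℝ) := by
        gcongr; exact enorm_velTensor_le u i j z.1 z.2
    _ = ‖u z.1 z.2‖ₑ ^ (3 : ℕ) := by
        rw [ENNReal.sq_rpow_three_halves, ← ENNReal.rpow_natCast]; norm_num

omit [MeasurableSpace α] in
/-- The pointwise continuity of the tensor: `|vᵢvⱼ - uᵢuⱼ| ≤ ‖v - u‖ (‖v‖ + ‖u‖)`. [folklore] -/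
theorem enorm_velTensor_sub_le (u v : α → UnitAddTorus d → EuclideanSpace ℝ d) (i j : d) (a : α)
    (x : UnitAddTorus d) :
    ‖velTensor v i j a x - velTensor u i j a x‖ₑ ≤ ‖v a x - u a x‖ₑ * (‖v a x‖ₑ + ‖u a x‖ₑ) := by
  have hc : ∀ (w : EuclideanSpace ℝ d) (k : d), |w k| ≤ ‖w‖ := fun w k => by
    simpa using PiLp.norm_apply_le w k
  have hreal : ‖velTensor v i j a x - velTensor u i j a x‖ ≤ ‖v a x - u a x‖ * (‖v a x‖ + ‖u a x‖) := by
    rw [velTensor, velTensor, Real.norm_eq_abs]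
    have e : v a x i * v a x j - u a x i * u a x j =
        v a x i * (v a x j - u a x j) + (v a x i - u a x i) * u a x j := by ring
    rw [e]
    calc |v a x i * (v a x j - u a x j) + (v a x i - u a x i) * u a x j|
        ≤ |v a x i| * |v a x j - u a x j| + |v a x i - u a x i| * |u a x j| := by
          refine (abs_add_le _ _).trans ?_; rw [abs_mul, abs_mul]
      _ ≤ ‖v a x‖ * ‖v a x - u a x‖ + ‖v a x - u a x‖ * ‖u a x‖ := by
          gcongr
          · exact hc _ _
          · simpa using hc (v a x - u a x) j
          · simpa using hc (v a x - u a x) i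
          · exact hc _ _
      _ = ‖v a x - u a x‖ * (‖v a x‖ + ‖u a x‖) := by ring
  calc ‖velTensor v i j a x - velTensor u i j a x‖ₑ
      = ENNReal.ofReal ‖velTensor v i j a x - velTensor u i j a x‖ := (ofReal_norm _).symm
    _ ≤ ENNReal.ofReal (‖v a x - u a x‖ * (‖v a x‖ + ‖u a x‖)) := ENNReal.ofReal_le_ofReal hreal
    _ = ‖v a x - u a x‖ₑ * (‖v a x‖ₑ + ‖u a x‖ₑ) := by
        rw [ENNReal.ofReal_mul (norm_nonneg _), ENNReal.ofReal_add (norm_nonneg _) (norm_nonneg _),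
          ofReal_norm, ofReal_norm, ofReal_norm]

/-- **`L^{3/2}` continuity of `u ↦ u ⊗ u` on `L³`** (Hölder): with `D = ∫⁻ ‖v - u‖³`,
`U = ∫⁻ ‖u‖³`, `V = ∫⁻ ‖v‖³`,
`∫⁻ |vᵢvⱼ - uᵢuⱼ|^{3/2} ≤ D^{1/2} (4 (V + U))^{1/2}`
(`‖u_m ⊗ u_m - u ⊗ u‖_{3/2} ≤ ‖u_m - u‖₃ (‖u_m‖₃ + ‖u‖₃)`; Duchon–Robert 2000, proof of Prop. 1). [folklore] -/
theorem lintegral_velTensor_sub_rpow_le [SFinite μ] (hum : AEStronglyMeasurable (uncurry u) (μ.prod volume))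
    (hvm : AEStronglyMeasurable (uncurry v) (μ.prod volume)) (i j : d) :
    ∫⁻ z, ‖velTensor v i j z.1 z.2 - velTensor u i j z.1 z.2‖ₑ ^ (3 / 2 : ℝ) ∂(μ.prod volume) ≤
      (∫⁻ z, ‖v z.1 z.2 - u z.1 z.2‖ₑ ^ (3 : ℕ) ∂(μ.prod volume)) ^ (1 / 2 : ℝ) *
        ((2 : ℝ≥0∞) ^ (2 : ℝ) * ((∫⁻ z, ‖v z.1 z.2‖ₑ ^ (3 : ℕ) ∂(μ.prod volume)) +
          ∫⁻ z, ‖u z.1 z.2‖ₑ ^ (3 : ℕ) ∂(μ.prod volume))) ^ (1 / 2 : ℝ) := by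
  set f : α × UnitAddTorus d → ℝ≥0∞ := fun z => ‖v z.1 z.2 - u z.1 z.2‖ₑ ^ (3 / 2 : ℝ) with hf
  set g : α × UnitAddTorus d → ℝ≥0∞ := fun z => (‖v z.1 z.2‖ₑ + ‖u z.1 z.2‖ₑ) ^ (3 / 2 : ℝ) with hg
  have hfm : AEMeasurable f (μ.prod volume) := ((hvm.sub hum).enorm.pow_const _)
  have hgm : AEMeasurable g (μ.prod volume) := (hvm.enorm.add hum.enorm).pow_const _
  have hpt : ∀ z, ‖velTensor v i j z.1 z.2 - velTensor u i j z.1 z.2‖ₑ ^ (3 / 2 : ℝ) ≤ f z * g z := by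
    intro z
    rw [hf, hg, ← ENNReal.mul_rpow_of_nonneg _ _ (by norm_num)]
    gcongr
    exact enorm_velTensor_sub_le u v i j z.1 z.2
  have hH : Real.HolderConjugate 2 2 := ⟨by norm_num, by norm_num, by norm_num⟩
  have hCS := ENNReal.lintegral_mul_le_Lp_mul_Lq (μ.prod volume) hH hfm hgm
  refine (lintegral_mono hpt).trans (hCS.trans ?_)
  simp only [Pi.mul_apply] at hCS ⊢
  have ef : ∀ z, f z ^ (2 : ℝ) = ‖v z.1 z.2 - u z.1 z.2‖ₑ ^ (3 : ℕ) := fun z => by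
    rw [hf, ← ENNReal.rpow_mul, ← ENNReal.rpow_natCast]; norm_num
  have eg : ∀ z, g z ^ (2 : ℝ) ≤ (2 : ℝ≥0∞) ^ (2 : ℝ) * (‖v z.1 z.2‖ₑ ^ (3 : ℕ) + ‖u z.1 z.2‖ₑ ^ (3 : ℕ)) := by
    intro z
    rw [hg, ← ENNReal.rpow_mul, show (3 / 2 : ℝ) * 2 = 3 by norm_num]
    have h := ENNReal.rpow_add_le_mul_rpow_add_rpow (‖v z.1 z.2‖ₑ) (‖u z.1 z.2‖ₑ) (p := 3) (by norm_num)
    rw [← ENNReal.rpow_natCast, ← ENNReal.rpow_natCast]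
    push_cast
    refine h.trans_eq ?_
    norm_num
  simp_rw [ef]
  gcongr
  calc ∫⁻ z, g z ^ (2 : ℝ) ∂(μ.prod volume)
      ≤ ∫⁻ z, (2 : ℝ≥0∞) ^ (2 : ℝ) * (‖v z.1 z.2‖ₑ ^ (3 : ℕ) + ‖u z.1 z.2‖ₑ ^ (3 : ℕ)) ∂(μ.prod volume) :=
        lintegral_mono eg
    _ = _ := by
        have hm1 : AEMeasurable (fun z : α × UnitAddTorus d => ‖v z.1 z.2‖ₑ ^ (3 : ℕ)) (μ.prod volume) :=
          hvm.enorm.pow_const _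
        rw [lintegral_const_mul' _ _ (ENNReal.rpow_ne_top_of_nonneg (by norm_num) ENNReal.ofNat_ne_top),
          lintegral_add_left' hm1]

/-- **`u_m → u` in `L³` implies `u_m ⊗ u_m → u ⊗ u` in `L^{3/2}`** on the product space
(Duchon–Robert 2000, proof of Prop. 1; Robinson–Rodrigo–Sadowski 2016, (5.10)). [folklore] -/
theorem tendsto_lintegral_velTensor_sub [SFinite μ] {useq : ℕ → α → UnitAddTorus d → EuclideanSpace ℝ d}
    (hum : AEStronglyMeasurable (uncurry u) (μ.prod volume))
    (hu3 : ∫⁻ z, ‖u z.1 z.2‖ₑ ^ (3 : ℕ) ∂(μ.prod volume) < ⊤)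
    (hmeas : ∀ᶠ m in atTop, AEStronglyMeasurable (uncurry (useq m)) (μ.prod volume))
    (hconv : Tendsto (fun m => ∫⁻ z, ‖useq m z.1 z.2 - u z.1 z.2‖ₑ ^ (3 : ℕ) ∂(μ.prod volume)) atTop (𝓝 0))
    (i j : d) :
    Tendsto (fun m => ∫⁻ z, ‖velTensor (useq m) i j z.1 z.2 - velTensor u i j z.1 z.2‖ₑ ^ (3 / 2 : ℝ)
      ∂(μ.prod volume)) atTop (𝓝 0) := by
  set U : ℝ≥0∞ := ∫⁻ z, ‖u z.1 z.2‖ₑ ^ (3 : ℕ) ∂(μ.prod volume) with hU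
  set D : ℕ → ℝ≥0∞ := fun m => ∫⁻ z, ‖useq m z.1 z.2 - u z.1 z.2‖ₑ ^ (3 : ℕ) ∂(μ.prod volume) with hD
  -- a uniform bound on `∫⁻ ‖u_m‖³`, eventually
  set M : ℝ≥0∞ := (2 : ℝ≥0∞) ^ (2 : ℝ) * ((2 : ℝ≥0∞) ^ (2 : ℝ) * (1 + U) + U) with hM
  have h4 : (2 : ℝ≥0∞) ^ (2 : ℝ) ≠ ⊤ := ENNReal.rpow_ne_top_of_nonneg (by norm_num) ENNReal.ofNat_ne_top
  have hMt : M ≠ ⊤ := by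
    rw [hM]
    exact ENNReal.mul_ne_top h4 (ENNReal.add_ne_top.2 ⟨ENNReal.mul_ne_top h4
      (ENNReal.add_ne_top.2 ⟨ENNReal.one_ne_top, hu3.ne⟩), hu3.ne⟩)
  have hD1 : ∀ᶠ m in atTop, D m ≤ 1 := hconv.eventually (eventually_le_nhds zero_lt_one)
  have hbound : ∀ᶠ m in atTop,
      ∫⁻ z, ‖velTensor (useq m) i j z.1 z.2 - velTensor u i j z.1 z.2‖ₑ ^ (3 / 2 : ℝ) ∂(μ.prod volume) ≤
        D m ^ (1 / 2 : ℝ) * M ^ (1 / 2 : ℝ) := by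
    filter_upwards [hmeas, hD1] with m hm hDm
    refine (lintegral_velTensor_sub_rpow_le hum hm i j).trans ?_
    gcongr
    -- `∫⁻ ‖u_m‖³ ≤ 4 (D_m + U) ≤ 4 (1 + U)`
    have hV : ∫⁻ z, ‖useq m z.1 z.2‖ₑ ^ (3 : ℕ) ∂(μ.prod volume) ≤ (2 : ℝ≥0∞) ^ (2 : ℝ) * (1 + U) := by
      have hpt : ∀ z : α × UnitAddTorus d, ‖useq m z.1 z.2‖ₑ ^ (3 : ℕ) ≤
          (2 : ℝ≥0∞) ^ (2 : ℝ) * (‖useq m z.1 z.2 - u z.1 z.2‖ₑ ^ (3 : ℕ) + ‖u z.1 z.2‖ₑ ^ (3 : ℕ)) := by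
        intro z
        have htri : ‖useq m z.1 z.2‖ₑ ≤ ‖useq m z.1 z.2 - u z.1 z.2‖ₑ + ‖u z.1 z.2‖ₑ := by
          calc ‖useq m z.1 z.2‖ₑ = ‖(useq m z.1 z.2 - u z.1 z.2) + u z.1 z.2‖ₑ := by rw [sub_add_cancel]
            _ ≤ _ := enorm_add_le _ _
        have h := ENNReal.rpow_add_le_mul_rpow_add_rpow (‖useq m z.1 z.2 - u z.1 z.2‖ₑ) (‖u z.1 z.2‖ₑ)
          (p := 3) (by norm_num)
        rw [← ENNReal.rpow_natCast, ← ENNReal.rpow_natCast, ← ENNReal.rpow_natCast]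
        push_cast
        refine (ENNReal.rpow_le_rpow htri (by norm_num)).trans (h.trans_eq ?_)
        norm_num
      calc ∫⁻ z, ‖useq m z.1 z.2‖ₑ ^ (3 : ℕ) ∂(μ.prod volume)
          ≤ ∫⁻ z, (2 : ℝ≥0∞) ^ (2 : ℝ) * (‖useq m z.1 z.2 - u z.1 z.2‖ₑ ^ (3 : ℕ) + ‖u z.1 z.2‖ₑ ^ (3 : ℕ))
              ∂(μ.prod volume) := lintegral_mono hpt
        _ = (2 : ℝ≥0∞) ^ (2 : ℝ) * (D m + U) := by
            have hm1 : AEMeasurable (fun z : α × UnitAddTorus d => ‖useq m z.1 z.2 - u z.1 z.2‖ₑ ^ (3 : ℕ))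
                (μ.prod volume) := (hm.sub hum).enorm.pow_const _
            rw [lintegral_const_mul' _ _ h4, lintegral_add_left' hm1]
        _ ≤ (2 : ℝ≥0∞) ^ (2 : ℝ) * (1 + U) := by gcongr
    rw [hM]
    gcongr
  have hlim : Tendsto (fun m => D m ^ (1 / 2 : ℝ) * M ^ (1 / 2 : ℝ)) atTop (𝓝 0) := by
    have h1 : Tendsto (fun m => D m ^ (1 / 2 : ℝ)) atTop (𝓝 0) := by
      have h := ((ENNReal.continuous_rpow_const (y := (1 / 2 : ℝ))).tendsto (0 : ℝ≥0∞)).comp hconv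
      rwa [ENNReal.zero_rpow_of_pos (by norm_num : (0 : ℝ) < 1 / 2)] at h
    have h2 := ENNReal.Tendsto.mul_const h1 (Or.inr (ENNReal.rpow_ne_top_of_nonneg (by norm_num : (0:ℝ) ≤ 1 / 2) hMt))
    rwa [zero_mul] at h2
  exact tendsto_of_tendsto_of_tendsto_of_le_of_le' tendsto_const_nhds hlim (Eventually.of_forall fun _ => zero_le)
    hbound

end VelTensor

end Literature.Analysis.FluidPDE.Torus

namespace Literature.Analysis.FluidPDE.Torus

open Literature.Analysis.FunctionSpaces Literature.Analysis.FunctionSpaces.Torus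

/-! ## The exponent `3/2` -/

section Exponent

/-- `(3/2 : ℝ≥0∞).toReal = 3/2`. [folklore] -/
theorem threeHalves_toReal : ((3 / 2 : ℝ≥0∞)).toReal = (3 / 2 : ℝ) := by
  rw [ENNReal.toReal_div, ENNReal.toReal_ofNat, ENNReal.toReal_ofNat]

/-- `1 < 3/2` in `ℝ≥0∞`. [folklore] -/
theorem one_lt_threeHalves : (1 : ℝ≥0∞) < 3 / 2 := by
  rw [ENNReal.lt_div_iff_mul_lt (Or.inl two_ne_zero) (Or.inl ENNReal.ofNat_ne_top)]; norm_num

/-- `3/2 < ∞` in `ℝ≥0∞`. [folklore] -/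
theorem threeHalves_lt_top : (3 / 2 : ℝ≥0∞) < ⊤ := ennreal_three_halves_ne_top.lt_top

end Exponent

/-! ## The Calderón–Zygmund fact feeds the hypothesis `HessianBound` -/

section Fact

variable {d : Type*} [Fintype d] [DecidableEq d]

/-- The named fact `Torus.eLpNorm_hessian_le_laplacian` (Robinson–Rodrigo–Sadowski 2016, Thm. B.7)
unfolds to `∀ p, 1 < p → p < ⊤ → ∃ C, HessianBound d p C`. [cite: RobinsonRodrigoSadowskiCUP2016, App. B Thm. B.7 (pp. 385–386)] -/
theorem hessianBound_of_fact (h : eLpNorm_hessian_le_laplacian d) {p : ℝ≥0∞} (hp1 : 1 < p) (hpt : p < ⊤) :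
    ∃ C : ℝ≥0, HessianBound d p C :=
  h p hp1 hpt

/-- The case `p = 2` of the hypothesis holds with `C = 1` (Parseval, `Torus.eLpNorm_hessian_le_laplacian_two`):
`HessianBound d 2 1` is inhabited unconditionally. [folklore] -/
theorem hessianBound_two : HessianBound d 2 1 := fun w hw j k => by
  simpa using eLpNorm_hessian_le_laplacian_two hw j k

end Fact

/-! ## The pressure at exponent `3/2` -/

section ThreeHalves

variable {d : Type*} [Fintype d] [DecidableEq d]
variable {α : Type*} [MeasurableSpace α] {μ : Measure α} [SFinite μ] {C : ℝ≥0}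

/-- `Torus.exists_pressure` at `p = 3/2`, with real exponents. [cite: RobinsonRodrigoSadowskiCUP2016, Lemma 5.1 and Prop. 5.3 (pp. 88–90)] -/
theorem exists_pressure_threeHalves [Nonempty d] (hC : HessianBound d (3 / 2) C)
    {G : d → d → α → UnitAddTorus d → ℝ}
    (hGm : ∀ i j, AEStronglyMeasurable (uncurry (G i j)) (μ.prod volume))
    (hGf : ∀ i j, ∫⁻ z, ‖G i j z.1 z.2‖ₑ ^ (3 / 2 : ℝ) ∂(μ.prod volume) < ⊤) :
    ∃ P : α → UnitAddTorus d → ℝ,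
      AEStronglyMeasurable (uncurry P) (μ.prod volume) ∧
      ∫⁻ z, ‖P z.1 z.2‖ₑ ^ (3 / 2 : ℝ) ∂(μ.prod volume) ≤
        presConst d (3 / 2) C * ∑ i, ∑ j, ∫⁻ z, ‖G i j z.1 z.2‖ₑ ^ (3 / 2 : ℝ) ∂(μ.prod volume) ∧
      Tendsto (fun n => ∫⁻ z, ‖presApprox (presMollifier n) G z.1 z.2 - P z.1 z.2‖ₑ ^ (3 / 2 : ℝ)
        ∂(μ.prod volume)) atTop (𝓝 0) ∧
      ∀ᵐ a ∂μ, ∀ φ : UnitAddTorus d → ℝ, IsSmooth φ →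
        ∫ x, P a x * Torus.laplacian φ x =
          -∑ i, ∑ j, ∫ x, G i j a x * Torus.partialDeriv i (Torus.partialDeriv j φ) x := by
  have hGf' : ∀ i j, ∫⁻ z, ‖G i j z.1 z.2‖ₑ ^ ((3 / 2 : ℝ≥0∞)).toReal ∂(μ.prod volume) < ⊤ := by
    simpa only [threeHalves_toReal] using hGf
  have h := exists_pressure (μ := μ) ennreal_one_le_three_halves ennreal_three_halves_ne_top hC hGm hGf'
  simpa only [threeHalves_toReal] using h

/-- `Torus.lintegral_prod_rpow_pressure_sub_le` at `p = 3/2`, with real exponents. [cite: RobinsonRodrigoSadowskiCUP2016, Lemma 5.1 (5.10) (p. 88)] -/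
theorem lintegral_prod_pressure_sub_le_threeHalves [Nonempty d] (hC : HessianBound d (3 / 2) C)
    {G G' : d → d → α → UnitAddTorus d → ℝ}
    (hGm : ∀ i j, AEStronglyMeasurable (uncurry (G i j)) (μ.prod volume))
    (hGf : ∀ i j, ∫⁻ z, ‖G i j z.1 z.2‖ₑ ^ (3 / 2 : ℝ) ∂(μ.prod volume) < ⊤)
    (hG'm : ∀ i j, AEStronglyMeasurable (uncurry (G' i j)) (μ.prod volume))
    (hG'f : ∀ i j, ∫⁻ z, ‖G' i j z.1 z.2‖ₑ ^ (3 / 2 : ℝ) ∂(μ.prod volume) < ⊤)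
    {P P' : α → UnitAddTorus d → ℝ} (hPm : AEStronglyMeasurable (uncurry P) (μ.prod volume))
    (hP'm : AEStronglyMeasurable (uncurry P') (μ.prod volume))
    (hP : Tendsto (fun n => ∫⁻ z, ‖presApprox (presMollifier n) G z.1 z.2 - P z.1 z.2‖ₑ ^ (3 / 2 : ℝ)
      ∂(μ.prod volume)) atTop (𝓝 0))
    (hP' : Tendsto (fun n => ∫⁻ z, ‖presApprox (presMollifier n) G' z.1 z.2 - P' z.1 z.2‖ₑ ^ (3 / 2 : ℝ)
      ∂(μ.prod volume)) atTop (𝓝 0)) :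
    ∫⁻ z, ‖P z.1 z.2 - P' z.1 z.2‖ₑ ^ (3 / 2 : ℝ) ∂(μ.prod volume) ≤
      presConst d (3 / 2) C * ∑ i, ∑ j, ∫⁻ z, ‖G i j z.1 z.2 - G' i j z.1 z.2‖ₑ ^ (3 / 2 : ℝ) ∂(μ.prod volume) := by
  have hGf₁ : ∀ i j, ∫⁻ z, ‖G i j z.1 z.2‖ₑ ^ ((3 / 2 : ℝ≥0∞)).toReal ∂(μ.prod volume) < ⊤ := by
    simpa only [threeHalves_toReal] using hGf
  have hG'f₁ : ∀ i j, ∫⁻ z, ‖G' i j z.1 z.2‖ₑ ^ ((3 / 2 : ℝ≥0∞)).toReal ∂(μ.prod volume) < ⊤ := by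
    simpa only [threeHalves_toReal] using hG'f
  have hP₁ : Tendsto (fun n => ∫⁻ z, ‖presApprox (presMollifier n) G z.1 z.2 - P z.1 z.2‖ₑ ^
      ((3 / 2 : ℝ≥0∞)).toReal ∂(μ.prod volume)) atTop (𝓝 0) := by simpa only [threeHalves_toReal] using hP
  have hP'₁ : Tendsto (fun n => ∫⁻ z, ‖presApprox (presMollifier n) G' z.1 z.2 - P' z.1 z.2‖ₑ ^
      ((3 / 2 : ℝ≥0∞)).toReal ∂(μ.prod volume)) atTop (𝓝 0) := by simpa only [threeHalves_toReal] using hP'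
  have h := lintegral_prod_rpow_pressure_sub_le ennreal_one_le_three_halves ennreal_three_halves_ne_top hC hGm hGf₁ hG'm hG'f₁
    hPm hP'm hP₁ hP'₁
  simpa only [threeHalves_toReal] using h

end ThreeHalves

/-! ## Assembly: the pressure of `L³` weak solutions and its continuity -/

section Assembly

variable {d : Type*} [Fintype d]
variable {T ν : ℝ} {u : ℝ → UnitAddTorus d → EuclideanSpace ℝ d}

/-- `L^{3/2} ⊂ L¹` on the finite measure space `(0,T) × T^d`. [folklore] -/
theorem lintegral_enorm_lt_top_of_threeHalves {P : ℝ → UnitAddTorus d → ℝ}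
    (hPm : AEStronglyMeasurable (uncurry P) ((volume.restrict (Ioo 0 T)).prod volume))
    (h : ∫⁻ z, ‖P z.1 z.2‖ₑ ^ (3 / 2 : ℝ) ∂((volume.restrict (Ioo 0 T)).prod volume) < ⊤) :
    ∫⁻ t in Ioo 0 T, ∫⁻ x, ‖P t x‖ₑ < ⊤ := by
  set μ2 := (volume.restrict (Ioo 0 T)).prod (volume : Measure (UnitAddTorus d)) with hμ2
  have hfin : eLpNorm (uncurry P) (3 / 2) μ2 < ⊤ := by
    rw [eLpNorm_eq_lintegral_rpow_enorm_toReal (one_lt_threeHalves.trans_le' zero_le |>.ne') ennreal_three_halves_ne_top,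
      threeHalves_toReal]
    exact ENNReal.rpow_lt_top_of_nonneg (by norm_num) h.ne
  have hle := eLpNorm_le_eLpNorm_mul_rpow_measure_univ (p := 1) (q := 3 / 2) ennreal_one_le_three_halves hPm (μ := μ2)
  have huniv : μ2 univ < ⊤ := by rw [hμ2, prod_Ioo_univ]; exact ENNReal.ofReal_lt_top
  have h1 : eLpNorm (uncurry P) 1 μ2 < ⊤ :=
    hle.trans_lt (ENNReal.mul_lt_top hfin (ENNReal.rpow_lt_top_of_nonneg (by
      rw [threeHalves_toReal]; norm_num) huniv.ne))
  rw [eLpNorm_one_eq_lintegral_enorm] at h1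
  rwa [lintegral_Ioo_lintegral_eq_lintegral_prod hPm.enorm]

variable [DecidableEq d]

/-- **The pressure of an `L³` weak solution on the torus** (Duchon–Robert 2000, proof of Prop. 1;
Robinson–Rodrigo–Sadowski 2016, Lemma 5.1 and Prop. 5.3): for a pressure-free weak solution `u`
on `T^d × (0,T)` with `u ∈ L³_{t,x}`, the `L^{3/2}` limit `P` of the approximate pressures of
`u ⊗ u` (`Torus.exists_pressure`) makes `(u, P)` a distributional solution, with
`∫∫ |P|^{3/2} ≤ K ∑ᵢⱼ ∫∫ |uᵢuⱼ|^{3/2} < ∞`. Modulo the Calderón–Zygmund hypothesis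
`HessianBound d (3/2) C`; `d` nonempty. [cite: RobinsonRodrigoSadowskiCUP2016, Lemma 5.1 and Prop. 5.3 (pp. 88–90)] -/
theorem exists_pressure_of_isWeakNSSolutionOn [Nonempty d] {C : ℝ≥0} (hC : HessianBound d (3 / 2) C)
    (hu : Torus.IsWeakNSSolutionOn T ν u)
    (hu3 : ∫⁻ z, ‖u z.1 z.2‖ₑ ^ (3 : ℕ) ∂((volume.restrict (Ioo 0 T)).prod volume) < ⊤) :
    ∃ P : ℝ → UnitAddTorus d → ℝ,
      AEStronglyMeasurable (uncurry P) ((volume.restrict (Ioo 0 T)).prod volume) ∧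
      ∫⁻ z, ‖P z.1 z.2‖ₑ ^ (3 / 2 : ℝ) ∂((volume.restrict (Ioo 0 T)).prod volume) ≤
        presConst d (3 / 2) C * ∑ i, ∑ j, ∫⁻ z, ‖velTensor u i j z.1 z.2‖ₑ ^ (3 / 2 : ℝ)
          ∂((volume.restrict (Ioo 0 T)).prod volume) ∧
      Tendsto (fun n => ∫⁻ z, ‖presApprox (presMollifier n) (velTensor u) z.1 z.2 - P z.1 z.2‖ₑ ^ (3 / 2 : ℝ)
        ∂((volume.restrict (Ioo 0 T)).prod volume)) atTop (𝓝 0) ∧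
      IsDistributionalNSSolutionOn T ν 0 u P ∧
      ∫⁻ t in Ioo 0 T, ∫⁻ x, ‖P t x‖ₑ ^ (3 / 2 : ℝ) < ⊤ := by
  set μ2 := (volume.restrict (Ioo 0 T)).prod (volume : Measure (UnitAddTorus d)) with hμ2
  have hum : AEStronglyMeasurable (uncurry u) μ2 := aestronglyMeasurable_uncurry_prod hu.1
  have hGm : ∀ i j, AEStronglyMeasurable (uncurry (velTensor u i j)) μ2 := fun i j =>
    aestronglyMeasurable_uncurry_velTensor hum i j
  have hGf : ∀ i j, ∫⁻ z, ‖velTensor u i j z.1 z.2‖ₑ ^ (3 / 2 : ℝ) ∂μ2 < ⊤ := fun i j =>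
    (lintegral_velTensor_rpow_le u i j).trans_lt hu3
  obtain ⟨P, hPm, hPb, hPlim, hPw⟩ := exists_pressure_threeHalves (μ := volume.restrict (Ioo 0 T)) hC hGm hGf
  have hSt : presConst d (3 / 2) C * ∑ i, ∑ j, ∫⁻ z, ‖velTensor u i j z.1 z.2‖ₑ ^ (3 / 2 : ℝ) ∂μ2 < ⊤ :=
    ENNReal.mul_lt_top (presConst_lt_top ennreal_one_le_three_halves ennreal_three_halves_ne_top)
      (ENNReal.sum_lt_top.2 fun i _ => ENNReal.sum_lt_top.2 fun j _ => hGf i j)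
  have hPf : ∫⁻ z, ‖P z.1 z.2‖ₑ ^ (3 / 2 : ℝ) ∂μ2 < ⊤ := hPb.trans_lt hSt
  have hP1 : ∫⁻ t in Ioo 0 T, ∫⁻ x, ‖P t x‖ₑ < ⊤ := lintegral_enorm_lt_top_of_threeHalves hPm hPf
  refine ⟨P, hPm, hPb, hPlim, hu.isDistributionalNSSolutionOn_of_pressure hPm hP1 hPw, ?_⟩
  rwa [lintegral_Ioo_lintegral_eq_lintegral_prod (hPm.enorm.pow_const _)]

omit [DecidableEq d] in
/-- For an empty index type every vector of `ℝ^d` vanishes, and a weak solution is a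
distributional solution with zero pressure. [folklore] -/
theorem isDistributionalNSSolutionOn_zero_of_isEmpty [IsEmpty d] [DecidableEq d]
    (hu : Torus.IsWeakNSSolutionOn T ν u) : IsDistributionalNSSolutionOn T ν 0 u (fun _ _ => 0) := by
  refine ⟨hu.1, hu.2.1, aestronglyMeasurable_const, by simp, hu.2.2.1, fun ψ hψ => ?_⟩
  have h0 : ∀ a : EuclideanSpace ℝ d, a = 0 := fun a => Subsingleton.elim a 0
  have hint : ∀ t x, ⟪u t x, Torus.timeDeriv ψ t x⟫_ℝ + ⟪u t x, Torus.convect (u t) (ψ t) x⟫_ℝ +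
      ν * ⟪u t x, Torus.laplacian (ψ t) x⟫_ℝ + (0 : ℝ) * Torus.divergence (ψ t) x +
      ⟪(0 : ℝ → UnitAddTorus d → EuclideanSpace ℝ d) t x, ψ t x⟫_ℝ = 0 := by
    intro t x
    rw [h0 (u t x)]
    simp
  simp_rw [hint, integral_zero]

omit [DecidableEq d] in
/-- **Proof of the named fact `Torus.exists_pressure_of_tendsto_L3`** (hypothesis (A1) of
`Torus.IsDissipationMeasureOf.hasDuchonRobertDefect_of`; Duchon–Robert 2000, proof of Prop. 1:
"`p ∈ L^{3/2}(0,T;L^{3/2})`" and the strong continuity of `uᵢuₖ ↦ p` on `L^q`;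
Robinson–Rodrigo–Sadowski 2016, Lemma 5.1 (5.7)/(5.10) and Prop. 5.3), **modulo the
Calderón–Zygmund fact** `Torus.eLpNorm_hessian_le_laplacian` (Robinson–Rodrigo–Sadowski 2016,
Thm. B.7): the pressures are the `L^{3/2}` limits of the approximate pressures of `u_m ⊗ u_m` and
`u ⊗ u` (`Torus.exists_pressure_of_isWeakNSSolutionOn`), defined eventually along the sequence
(where `u_m` is a weak solution in `L³`), and `p_m → p` in `L^{3/2}` by the continuity of the
pressure in the data (`Torus.lintegral_prod_rpow_pressure_sub_le`) and
`‖u_m ⊗ u_m - u ⊗ u‖_{3/2} ≤ ‖u_m - u‖₃(‖u_m‖₃ + ‖u‖₃)` (`Torus.tendsto_lintegral_velTensor_sub`).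
For empty `d` all fields vanish and zero pressures do. [cite: DuchonRobert2000, proof of Prop. 1 (pp. 250–251)] [cite: RobinsonRodrigoSadowskiCUP2016, Lemma 5.1 and Prop. 5.3 (pp. 88–90)] -/
theorem exists_pressure_of_tendsto_L3_of (hCZ : eLpNorm_hessian_le_laplacian d) :
    exists_pressure_of_tendsto_L3 (T := T) (u := u) := by
  intro _ νseq ν useq hsol hu hconv hu3
  set μ2 := (volume.restrict (Ioo 0 T)).prod (volume : Measure (UnitAddTorus d)) with hμ2
  rcases isEmpty_or_nonempty d with hd | hd
  · -- empty index type: everything vanishes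
    refine ⟨fun _ _ _ => 0, fun _ _ => 0, ?_, isDistributionalNSSolutionOn_zero_of_isEmpty hu, by simp, ?_⟩
    · filter_upwards [hsol] with m hm
      exact ⟨isDistributionalNSSolutionOn_zero_of_isEmpty hm, by simp⟩
    · simp only [sub_zero, enorm_zero, ENNReal.zero_rpow_of_pos (by norm_num : (0 : ℝ) < 3 / 2),
        lintegral_const, zero_mul]
      exact tendsto_const_nhds
  -- the generic case
  obtain ⟨C, hC⟩ := hessianBound_of_fact hCZ one_lt_threeHalves threeHalves_lt_top
  have hum : AEStronglyMeasurable (uncurry u) μ2 := aestronglyMeasurable_uncurry_prod hu.1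
  have hu3' : ∫⁻ z, ‖u z.1 z.2‖ₑ ^ (3 : ℕ) ∂μ2 < ⊤ := by
    rwa [lintegral_Ioo_lintegral_eq_lintegral_prod (hum.enorm.pow_const _)] at hu3
  -- the limit pressure
  obtain ⟨P, hPm, hPb, hPlim, hPsol, hP32⟩ := exists_pressure_of_isWeakNSSolutionOn hC hu hu3'
  -- the sequence: good indices
  have hmeas : ∀ᶠ m in atTop, AEStronglyMeasurable (uncurry (useq m)) μ2 := by
    filter_upwards [hsol] with m hm; exact aestronglyMeasurable_uncurry_prod hm.1
  have hconv' : Tendsto (fun m => ∫⁻ z, ‖useq m z.1 z.2 - u z.1 z.2‖ₑ ^ (3 : ℕ) ∂μ2) atTop (𝓝 0) := by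
    refine (tendsto_congr' ?_).1 hconv
    filter_upwards [hmeas] with m hm
    exact lintegral_Ioo_lintegral_eq_lintegral_prod ((hm.sub hum).enorm.pow_const _)
  have hfin : ∀ᶠ m in atTop, ∫⁻ z, ‖useq m z.1 z.2‖ₑ ^ (3 : ℕ) ∂μ2 < ⊤ := by
    have h := eventually_lintegral_enorm_pow_three_lt_top hmeas hum hconv hu3
    filter_upwards [h, hmeas] with m hm hmm
    rwa [lintegral_Ioo_lintegral_eq_lintegral_prod (hmm.enorm.pow_const _)] at hm
  -- pressures along the sequence (zero at the finitely many bad indices)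
  classical
  have hex : ∀ m, Torus.IsWeakNSSolutionOn T (νseq m) (useq m) ∧ ∫⁻ z, ‖useq m z.1 z.2‖ₑ ^ (3 : ℕ) ∂μ2 < ⊤ →
      ∃ Pm : ℝ → UnitAddTorus d → ℝ,
        AEStronglyMeasurable (uncurry Pm) μ2 ∧
        ∫⁻ z, ‖Pm z.1 z.2‖ₑ ^ (3 / 2 : ℝ) ∂μ2 ≤
          presConst d (3 / 2) C * ∑ i, ∑ j, ∫⁻ z, ‖velTensor (useq m) i j z.1 z.2‖ₑ ^ (3 / 2 : ℝ) ∂μ2 ∧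
        Tendsto (fun n => ∫⁻ z, ‖presApprox (presMollifier n) (velTensor (useq m)) z.1 z.2 - Pm z.1 z.2‖ₑ ^
          (3 / 2 : ℝ) ∂μ2) atTop (𝓝 0) ∧
        IsDistributionalNSSolutionOn T (νseq m) 0 (useq m) Pm ∧
        ∫⁻ t in Ioo 0 T, ∫⁻ x, ‖Pm t x‖ₑ ^ (3 / 2 : ℝ) < ⊤ := fun m h =>
    exists_pressure_of_isWeakNSSolutionOn hC h.1 h.2
  set pseq : ℕ → ℝ → UnitAddTorus d → ℝ := fun m =>
    if h : Torus.IsWeakNSSolutionOn T (νseq m) (useq m) ∧ ∫⁻ z, ‖useq m z.1 z.2‖ₑ ^ (3 : ℕ) ∂μ2 < ⊤ then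
      (hex m h).choose else fun _ _ => 0 with hpseq_def
  have hpseq : ∀ m (h : Torus.IsWeakNSSolutionOn T (νseq m) (useq m) ∧ ∫⁻ z, ‖useq m z.1 z.2‖ₑ ^ (3 : ℕ) ∂μ2 < ⊤),
      AEStronglyMeasurable (uncurry (pseq m)) μ2 ∧
        ∫⁻ z, ‖pseq m z.1 z.2‖ₑ ^ (3 / 2 : ℝ) ∂μ2 ≤
          presConst d (3 / 2) C * ∑ i, ∑ j, ∫⁻ z, ‖velTensor (useq m) i j z.1 z.2‖ₑ ^ (3 / 2 : ℝ) ∂μ2 ∧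
        Tendsto (fun n => ∫⁻ z, ‖presApprox (presMollifier n) (velTensor (useq m)) z.1 z.2 - pseq m z.1 z.2‖ₑ ^
          (3 / 2 : ℝ) ∂μ2) atTop (𝓝 0) ∧
        IsDistributionalNSSolutionOn T (νseq m) 0 (useq m) (pseq m) ∧
        ∫⁻ t in Ioo 0 T, ∫⁻ x, ‖pseq m t x‖ₑ ^ (3 / 2 : ℝ) < ⊤ := by
    intro m h
    have e : pseq m = (hex m h).choose := by simp only [hpseq_def, dif_pos h]
    rw [e]
    exact (hex m h).choose_spec
  refine ⟨pseq, P, ?_, hPsol, hP32, ?_⟩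
  · filter_upwards [hsol, hfin] with m hm hfm
    obtain ⟨-, -, -, hsolm, h32m⟩ := hpseq m ⟨hm, hfm⟩
    exact ⟨hsolm, h32m⟩
  · -- convergence of the pressures
    have hGm : ∀ i j, AEStronglyMeasurable (uncurry (velTensor u i j)) μ2 := fun i j =>
      aestronglyMeasurable_uncurry_velTensor hum i j
    have hGf : ∀ i j, ∫⁻ z, ‖velTensor u i j z.1 z.2‖ₑ ^ (3 / 2 : ℝ) ∂μ2 < ⊤ := fun i j =>
      (lintegral_velTensor_rpow_le u i j).trans_lt hu3'
    have hΔ : ∀ i j, Tendsto (fun m => ∫⁻ z, ‖velTensor (useq m) i j z.1 z.2 - velTensor u i j z.1 z.2‖ₑ ^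
        (3 / 2 : ℝ) ∂μ2) atTop (𝓝 0) := fun i j =>
      tendsto_lintegral_velTensor_sub hum hu3' hmeas hconv' i j
    have hbound : ∀ᶠ m in atTop, ∫⁻ t in Ioo 0 T, ∫⁻ x, ‖pseq m t x - P t x‖ₑ ^ (3 / 2 : ℝ) ≤
        presConst d (3 / 2) C * ∑ i, ∑ j,
          ∫⁻ z, ‖velTensor (useq m) i j z.1 z.2 - velTensor u i j z.1 z.2‖ₑ ^ (3 / 2 : ℝ) ∂μ2 := by
      filter_upwards [hsol, hfin, hmeas] with m hm hfm hmm
      obtain ⟨hPmm, -, hPmlim, -, -⟩ := hpseq m ⟨hm, hfm⟩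
      have hGmm : ∀ i j, AEStronglyMeasurable (uncurry (velTensor (useq m) i j)) μ2 := fun i j =>
        aestronglyMeasurable_uncurry_velTensor hmm i j
      have hGfm : ∀ i j, ∫⁻ z, ‖velTensor (useq m) i j z.1 z.2‖ₑ ^ (3 / 2 : ℝ) ∂μ2 < ⊤ := fun i j =>
        (lintegral_velTensor_rpow_le (useq m) i j).trans_lt hfm
      rw [lintegral_Ioo_lintegral_eq_lintegral_prod ((hPmm.sub hPm).enorm.pow_const _)]
      exact lintegral_prod_pressure_sub_le_threeHalves hC hGmm hGfm hGm hGf hPmm hPm hPmlim hPlim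
    have hlim : Tendsto (fun m => presConst d (3 / 2) C * ∑ i, ∑ j,
        ∫⁻ z, ‖velTensor (useq m) i j z.1 z.2 - velTensor u i j z.1 z.2‖ₑ ^ (3 / 2 : ℝ) ∂μ2) atTop (𝓝 0) := by
      have hs : Tendsto (fun m => ∑ i, ∑ j,
          ∫⁻ z, ‖velTensor (useq m) i j z.1 z.2 - velTensor u i j z.1 z.2‖ₑ ^ (3 / 2 : ℝ) ∂μ2) atTop (𝓝 0) := by
        have := tendsto_finsetSum (Finset.univ : Finset d) (a := fun _ => (0 : ℝ≥0∞))
          (f := fun i m => ∑ j, ∫⁻ z, ‖velTensor (useq m) i j z.1 z.2 - velTensor u i j z.1 z.2‖ₑ ^ (3 / 2 : ℝ) ∂μ2)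
          (x := (atTop : Filter ℕ)) fun i _ => by
            have := tendsto_finsetSum (Finset.univ : Finset d) (a := fun _ => (0 : ℝ≥0∞))
              (f := fun j m => ∫⁻ z, ‖velTensor (useq m) i j z.1 z.2 - velTensor u i j z.1 z.2‖ₑ ^ (3 / 2 : ℝ) ∂μ2)
              (x := (atTop : Filter ℕ)) fun j _ => hΔ i j
            simpa using this
        simpa using this
      simpa using ENNReal.Tendsto.const_mul hs (Or.inr (presConst_lt_top ennreal_one_le_three_halves ennreal_three_halves_ne_top).ne)
    exact tendsto_of_tendsto_of_tendsto_of_le_of_le' tendsto_const_nhds hlim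
      (Eventually.of_forall fun _ => zero_le) hbound

end Assembly

end Literature.Analysis.FluidPDE.Torus
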